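import Literature.MathematicalPhysics.QuantumManyBody.BogoliubovExpansion
import HarnessLib

/-!
# Bounds for the Bogoliubov-conjugated quartic words: the Cauchy–Schwarz lemma for
# momentum-conserving two-body kernels and the normal-ordered `G₃` (pair-creation) block

Topic `Literature/MathematicalPhysics/QuantumManyBody`, namespace `BoseGas.Fock`; theorem-only sequel
of `BogoliubovExpansion.lean` for the provefact
`Literature.MathematicalPhysics.QuantumManyBody.BoseGas.BastiCenatiempoSchlein2021_upperBound`
(§4 of [BastiCenatiempoSchlein2021], the estimates of `G₂`, `G₃` and of the non-`P_H` part of `G₁`).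

* **Cauchy–Schwarz for momentum-conserving two-body kernels**
  (`norm_sum_kernel_fockInner_pderiv_pderiv_le`): for injective momentum labels and a kernel
  `K(x,y,x',y')` supported on `e x + e y = e x' + e y'` with `|K| ≤ B φ(x) φ(x')`,
  `|∑ K ⟨a_ya_xξ, a_{y'}a_{x'}ξ⟩| ≤ B (∑_x φ(x)²) ∑_{x,y} ‖a_ya_xξ‖²` — the common shape of the
  bounds `C N^{κ-1} ‖σ_S‖²_∞ ‖σ‖² ‖(𝒩+1)ξ_ν‖²` (for `G₃`), `C N^{κ-1}‖γ_S‖²_∞‖σ‖²‖(𝒩+1)ξ_ν‖²`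
  (for `G₂`) and `C N^{κ-1}‖γ‖²_∞‖γ_S‖²‖(𝒩+1)ξ_ν‖²` (for `G₁`) of [ibid., §4]: for fixed `x, x'`
  the momentum constraint makes `y ↦ y'` injective, so the `y`-sum is a Cauchy–Schwarz pairing of
  `‖a_•a_xξ‖` with `‖a_•a_{x'}ξ‖`, and then `(∑_x φ(x)‖𝒩^{1/2}a_xξ‖)² ≤ ∑φ² · ∑‖𝒩^{1/2}a_xξ‖²`.
* **Weighted number sums** (`norm_sum_mul_fockInner_pderiv_le`): `|∑_p c_p ‖a_pξ‖²| ≤ (max|c|) ∑‖a_pξ‖²`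
  on the support of `a_•ξ`; tools: Wick's rule flattened (`fockInner_X_mul_X_mul_X_mul_X_mul'`),
  reindexing along the involution and block swaps (`sum_comp_involutive`, `sum_comm₂₂`), restriction of
  a two-body kernel to the support (`sum_kernel_eq_sum_restrict`), collapsing sums
  (`sum_sum_ite_and_eq`).
* **The `G₃` block** (`norm_G3_sub_const_le`): the pair-creation/pair-creation pairing
  `∑ c σ_qσ_pσ_{q'}σ_{p'}⟨X_{σq}X_{σp}ξ, X_{σq'}X_{σp'}ξ⟩` normal ordered into its two constants
  `(∑_{p,q}W(e q - e p)σ_p²σ_q² + W(0)(∑σ²)²)‖ξ‖²` (kept exactly; `(1/2N)∑V̂(r)σ_p²σ_{p+r}² + (1/2N)∑V̂(0)σ_p²σ_q²`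
  in [ibid.]) plus number and two-body terms bounded by
  `4W₀(∑σ²)s₀² ∑‖a_pξ‖² + W₀s₀²(∑_{Q}σ²) ∑‖a_ya_xξ‖²` — the bound (4.G3)
  `C N^{κ-1}[‖σ_S‖²_∞‖σ‖²‖(𝒩+1)ξ_ν‖² + ‖σ‖⁴‖ξ_ν‖²]`.
* **Counting** (appended; `sum_ite_mom_const_le`, `sum4_ite_mom_le_A/B/C/D`, `sum4_ite_mom_le_drop₁…₄`):
  in a momentum-conserving four-fold sum any one index is determined by the other three, so a
  non-negative summand not depending on it can be summed over the remaining three indices only.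
* **The `G₂` block** (appended; `fockInner_Z_Z_expand`, `norm_G2_sub_const_le`): with
  `Z_{qp}ξ = γ_qσ_p a_q(a†_{σp}ξ) + σ_qγ_p a†_{σq}(a_pξ)` (the number-conserving words of `B_qB_p`),
  `⟨Z_{qp}ξ, Z_{q'p'}ξ⟩` expands into thirteen normal-ordered pieces; summed against the pair
  coefficient the constant `(∑_{p,p'} W(e p' - e p) γ_pσ_pγ_{p'}σ_{p'})‖ξ‖²` is kept exactly
  (`(1/2N)∑V̂(r)γ_pγ_{p+r}σ_pσ_{p+r}` in [ibid.]) and the rest is bounded by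
  `4gs₀Λ∑‖a_pξ‖² + 4W₀(∑σ²)g₀²∑‖a_pξ‖² + 4W₀g₀²(∑σ²)∑‖a_ya_xξ‖²` (`|γ| ≤ g₀`, `|γσ| ≤ gs₀` on the
  support, `Λ ≥ ∑_p|W(k - e p)||γ_pσ_p|`): the bounds (4.G2) of [ibid.]; the two-body pieces by the
  termwise AM–GM pairing of each `σ`-weight with the hole vector not containing its index plus the
  counting lemmas.
* **The `G₁` block** (appended; `norm_G1_sub_H_le`): for a vector annihilated off `P_H ∪ P_S` and
  weighted-homogeneous for the `P_H/P_S` particle count, the pair-annihilation block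
  `∑ c γ_qγ_pγ_{q'}γ_{p'}⟨a_qa_pξ, a_{q'}a_{p'}ξ⟩` equals its restriction to `P_H⁴` up to
  `2W₀g₀⁴|P_S| ∑‖a_ya_xξ‖²` ("the operator preserves the number of particles in `P_S` and `P_H`";
  a surviving term outside `P_H⁴` has a `P_S` mode on each side and at most `|P_S|` momentum
  partners) — the bound `CN^{κ-1}‖γ_{S∪H}‖²_∞‖γ_S‖²‖(𝒩+1)ξ_ν‖²` of [ibid.]; the `P_H⁴` part is the
  input of `CubicTrialVectorPairing.quartic_pairing_decomposition`.
* **The quadratic block `ℒ⁽²⁾`** (appended; `L2_block_expand`, `norm_L2_block_sub_const_le`): the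
  `N₀`-part of the Weyl-reduced quartic form for a graded vector is the constant
  `∑_p [(2W(0)+W(e p)+W(-e p))σ_p² + (W(e p)+W(-e p))γ_pσ_p]‖ξ‖²` (the `𝒢^{(2,V)}_N` constant of
  [ibid.]) plus number-operator terms bounded by `4W₀(g₀²+s₀²+gs₀)∑‖a_pξ‖²`.

## References

* [BastiCenatiempoSchlein2021] G. Basti, S. Cenatiempo, B. Schlein, Forum Math. Sigma 9 (2021) e74,
  arXiv:2101.06222: §4 (normal ordering and bounds of `G₃` and `G₂`; the non-`P_H` part of `G₁`).
-/

noncomputable section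

namespace Literature.MathematicalPhysics.QuantumManyBody.BoseGas

open Complex MvPolynomial Finset
open scoped ComplexConjugate BigOperators

namespace Fock

section CauchySchwarz

variable {ι : Type*} [Fintype ι] {e : ι → Momentum}

omit [Fintype ι] in
/-- `‖⟨u, v⟩‖ ≤ √re⟨u,u⟩ √re⟨v,v⟩`. [folklore] -/
theorem norm_fockInner_le_sqrt_mul_sqrt (u v : MvPolynomial ι ℂ) :
    ‖fockInner u v‖ ≤ Real.sqrt (fockInner u u).re * Real.sqrt (fockInner v v).re := by
  have h := norm_fockInner_sq_le u v
  have hu := fockInner_self_re_nonneg u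
  have hv := fockInner_self_re_nonneg v
  rw [← Real.sqrt_mul hu, ← Real.sqrt_sq (norm_nonneg (fockInner u v))]
  exact Real.sqrt_le_sqrt h

/-- A sum over the modes of a given momentum has at most one term (injective labels). [folklore] -/
theorem sum_ite_momentum_eq_const (he : Function.Injective e) (k : Momentum) (F : ι → ℝ) :
    ∑ y, (if e y = k then F y else 0) = if h : ∃ y, e y = k then F h.choose else 0 := by
  classical
  split_ifs with h
  · have hc : e h.choose = k := h.choose_spec
    rw [Finset.sum_eq_single h.choose]
    · rw [if_pos hc]
    · intro y _ hy
      rw [if_neg]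
      intro hey
      exact hy (he (hey.trans hc.symm))
    · intro hh; exact absurd (Finset.mem_univ _) hh
  · push Not at h
    exact Finset.sum_eq_zero fun y _ => if_neg (h y)

/-- `(∑_y [e y = k] b_y)² ≤ ∑_y [e y = k] b_y²` (at most one term). [folklore] -/
theorem sq_sum_ite_momentum_le (he : Function.Injective e) (k : Momentum) (b : ι → ℝ) :
    (∑ y, (if e y = k then b y else 0)) ^ 2 ≤ ∑ y, (if e y = k then b y ^ 2 else 0) := by
  rw [sum_ite_momentum_eq_const he k b, sum_ite_momentum_eq_const he k (fun y => b y ^ 2)]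
  split_ifs
  · exact le_rfl
  · norm_num

/-- `∑_y [e y = k] c ≤ c` for `c ≥ 0` (at most one term). [folklore] -/
theorem sum_ite_momentum_const_le (he : Function.Injective e) (k : Momentum) {c : ℝ} (hc : 0 ≤ c) :
    ∑ y, (if e y = k then c else 0) ≤ c := by
  rw [sum_ite_momentum_eq_const he k (fun _ => c)]
  split_ifs
  · exact le_rfl
  · exact hc

/-- **The momentum-constrained pairing of two families is a Cauchy–Schwarz pairing**: for
`a, b ≥ 0`, `∑_{y,y'} [e y' = k + e y] a_y b_{y'} ≤ √(∑a²) √(∑b²)` (for fixed `y` at most one `y'`,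
for fixed `y'` at most one `y`). [folklore] -/
theorem sum_sum_ite_momentum_mul_le (he : Function.Injective e) (k : Momentum) (a b : ι → ℝ)
    (ha : ∀ y, 0 ≤ a y) (hb : ∀ y, 0 ≤ b y) :
    ∑ y, ∑ y', (if e y' = k + e y then a y * b y' else 0) ≤
      Real.sqrt (∑ y, a y ^ 2) * Real.sqrt (∑ y', b y' ^ 2) := by
  -- `g y = ∑_{y'} [e y' = k + e y] b y'`
  set g : ι → ℝ := fun y => ∑ y', (if e y' = k + e y then b y' else 0) with hg
  have hrw : ∑ y, ∑ y', (if e y' = k + e y then a y * b y' else 0) = ∑ y, a y * g y := by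
    refine Finset.sum_congr rfl fun y _ => ?_
    rw [hg, Finset.mul_sum]
    refine Finset.sum_congr rfl fun y' _ => ?_
    split_ifs <;> simp
  rw [hrw]
  have hcs := Finset.sum_mul_sq_le_sq_mul_sq (Finset.univ : Finset ι) a g
  have hg2 : ∑ y, g y ^ 2 ≤ ∑ y', b y' ^ 2 := by
    calc ∑ y, g y ^ 2 ≤ ∑ y, ∑ y', (if e y' = k + e y then b y' ^ 2 else 0) :=
          Finset.sum_le_sum fun y _ => sq_sum_ite_momentum_le he _ b
      _ = ∑ y', ∑ y, (if e y' = k + e y then b y' ^ 2 else 0) := Finset.sum_comm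
      _ ≤ ∑ y', b y' ^ 2 := by
          refine Finset.sum_le_sum fun y' _ => ?_
          have : ∀ y, (e y' = k + e y) ↔ (e y = e y' - k) := fun y => by
            constructor <;> intro h
            · rw [h]; abel
            · rw [h]; abel
          simp_rw [this]
          exact sum_ite_momentum_const_le he _ (sq_nonneg _)
  have hA : 0 ≤ ∑ y, a y ^ 2 := Finset.sum_nonneg fun y _ => sq_nonneg _
  have hG : 0 ≤ ∑ y, g y ^ 2 := Finset.sum_nonneg fun y _ => sq_nonneg _
  have hlhs : 0 ≤ ∑ y, a y * g y :=
    Finset.sum_nonneg fun y _ => mul_nonneg (ha y) (Finset.sum_nonneg fun y' _ => by split_ifs <;> [exact hb y'; exact le_rfl])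
  calc ∑ y, a y * g y ≤ Real.sqrt (∑ y, a y ^ 2) * Real.sqrt (∑ y, g y ^ 2) := by
        rw [← Real.sqrt_mul hA, ← Real.sqrt_sq hlhs]
        exact Real.sqrt_le_sqrt hcs
    _ ≤ Real.sqrt (∑ y, a y ^ 2) * Real.sqrt (∑ y', b y' ^ 2) :=
        mul_le_mul_of_nonneg_left (Real.sqrt_le_sqrt hg2) (Real.sqrt_nonneg _)

/-- **Cauchy–Schwarz for momentum-conserving two-body kernels.** If `e` is injective and the kernel
satisfies `|K(x,y,x',y')| ≤ [e x + e y = e x' + e y'] B φ(x) φ(x')` (`B, φ ≥ 0`), then for every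
finite-excitation vector `ξ`
`|∑_{x,y,x',y'} K(x,y,x',y') ⟨a_ya_xξ, a_{y'}a_{x'}ξ⟩| ≤ B (∑_x φ(x)²) ∑_{x,y} ‖a_ya_xξ‖²`.
[cite: BastiCenatiempoSchlein2021, §4 (bounds for `G₂`, `G₃` and the non-`P_H` part of `G₁` by `‖(𝒩+1)ξ_ν‖²`)] -/
theorem norm_sum_kernel_fockInner_pderiv_pderiv_le (he : Function.Injective e) (K : ι → ι → ι → ι → ℂ)
    (φ : ι → ℝ) (hφ : ∀ x, 0 ≤ φ x) {B : ℝ} (hB : 0 ≤ B)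
    (hK : ∀ x y x' y', ‖K x y x' y'‖ ≤ (if e x + e y = e x' + e y' then B * (φ x * φ x') else 0))
    (ξ : MvPolynomial ι ℂ) :
    ‖∑ x, ∑ y, ∑ x', ∑ y', K x y x' y' * fockInner (pderiv y (pderiv x ξ)) (pderiv y' (pderiv x' ξ))‖ ≤
      B * (∑ x, φ x ^ 2) * ∑ x, ∑ y, (fockInner (pderiv y (pderiv x ξ)) (pderiv y (pderiv x ξ))).re := by
  -- the norms of the two-hole vectors and the restricted number expectations
  set a : ι → ι → ℝ := fun x y => Real.sqrt (fockInner (pderiv y (pderiv x ξ)) (pderiv y (pderiv x ξ))).re with ha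
  have ha0 : ∀ x y, 0 ≤ a x y := fun x y => Real.sqrt_nonneg _
  have ha2 : ∀ x y, a x y ^ 2 = (fockInner (pderiv y (pderiv x ξ)) (pderiv y (pderiv x ξ))).re :=
    fun x y => Real.sq_sqrt (fockInner_self_re_nonneg _)
  set n : ι → ℝ := fun x => ∑ y, a x y ^ 2 with hn
  have hn0 : ∀ x, 0 ≤ n x := fun x => Finset.sum_nonneg fun y _ => sq_nonneg _
  -- reorder: `x, x'` outside, `y, y'` inside
  have hre : ∑ x, ∑ y, ∑ x', ∑ y', K x y x' y' * fockInner (pderiv y (pderiv x ξ)) (pderiv y' (pderiv x' ξ)) =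
      ∑ x, ∑ x', ∑ y, ∑ y', K x y x' y' * fockInner (pderiv y (pderiv x ξ)) (pderiv y' (pderiv x' ξ)) :=
    Finset.sum_congr rfl fun x _ => Finset.sum_comm
  rw [hre]
  -- termwise
  have hterm : ∀ x x' y y', ‖K x y x' y' * fockInner (pderiv y (pderiv x ξ)) (pderiv y' (pderiv x' ξ))‖ ≤
      B * (φ x * φ x') * (if e y' = (e x - e x') + e y then a x y * a x' y' else 0) := by
    intro x x' y y'
    rw [norm_mul]
    refine le_trans (mul_le_mul (hK x y x' y') (norm_fockInner_le_sqrt_mul_sqrt _ _) (norm_nonneg _)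
      (by split_ifs <;> [exact mul_nonneg hB (mul_nonneg (hφ x) (hφ x')); exact le_rfl])) ?_
    have hiff : (e x + e y = e x' + e y') ↔ (e y' = (e x - e x') + e y) := by
      constructor <;> intro h
      · rw [sub_add_eq_add_sub, h]; abel
      · rw [h]; abel
    by_cases hm : e x + e y = e x' + e y'
    · rw [if_pos hm, if_pos (hiff.1 hm)]
    · rw [if_neg hm, if_neg (fun h => hm (hiff.2 h)), zero_mul, mul_zero]
  calc ‖∑ x, ∑ x', ∑ y, ∑ y', K x y x' y' * fockInner (pderiv y (pderiv x ξ)) (pderiv y' (pderiv x' ξ))‖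
      ≤ ∑ x, ∑ x', ∑ y, ∑ y', B * (φ x * φ x') * (if e y' = (e x - e x') + e y then a x y * a x' y' else 0) :=
        norm_sum_le_of_le _ fun x _ => norm_sum_le_of_le _ fun x' _ => norm_sum_le_of_le _ fun y _ =>
          norm_sum_le_of_le _ fun y' _ => hterm x x' y y'
    _ = ∑ x, ∑ x', B * (φ x * φ x') * ∑ y, ∑ y', (if e y' = (e x - e x') + e y then a x y * a x' y' else 0) := by
        simp only [Finset.mul_sum]
    _ ≤ ∑ x, ∑ x', B * (φ x * φ x') * (Real.sqrt (n x) * Real.sqrt (n x')) := by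
        refine Finset.sum_le_sum fun x _ => Finset.sum_le_sum fun x' _ => ?_
        refine mul_le_mul_of_nonneg_left ?_ (mul_nonneg hB (mul_nonneg (hφ x) (hφ x')))
        exact sum_sum_ite_momentum_mul_le he (e x - e x') (a x) (a x') (ha0 x) (ha0 x')
    _ = B * (∑ x, φ x * Real.sqrt (n x)) ^ 2 := by
        rw [sq, Finset.sum_mul_sum, Finset.mul_sum]
        refine Finset.sum_congr rfl fun x _ => ?_
        rw [Finset.mul_sum]
        refine Finset.sum_congr rfl fun x' _ => ?_
        ring
    _ ≤ B * ((∑ x, φ x ^ 2) * ∑ x, Real.sqrt (n x) ^ 2) :=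
        mul_le_mul_of_nonneg_left (Finset.sum_mul_sq_le_sq_mul_sq _ _ _) hB
    _ = B * (∑ x, φ x ^ 2) * ∑ x, ∑ y, (fockInner (pderiv y (pderiv x ξ)) (pderiv y (pderiv x ξ))).re := by
        rw [mul_assoc]
        congr 2
        refine Finset.sum_congr rfl fun x _ => ?_
        rw [Real.sq_sqrt (hn0 x), hn]
        exact Finset.sum_congr rfl fun y _ => ha2 x y

/-- **Weighted number sums**: if `a_pξ = 0` off a set `Q` and `|c_p| ≤ c₀` on `Q`, then
`|∑_p c_p ‖a_pξ‖²| ≤ c₀ ∑_p ‖a_pξ‖²`. [cite: BastiCenatiempoSchlein2021, §4 (`|⟨ξ_ν, E₁ξ_ν⟩| ≤ CN^κ‖𝒩^{1/2}ξ_ν‖²` and the like)] -/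
theorem norm_sum_mul_fockInner_pderiv_le (c : ι → ℂ) (Q : Finset ι) {c₀ : ℝ}
    (hc : ∀ p ∈ Q, ‖c p‖ ≤ c₀) (ξ : MvPolynomial ι ℂ) (hξ : ∀ p ∉ Q, pderiv p ξ = 0) :
    ‖∑ p, c p * fockInner (pderiv p ξ) (pderiv p ξ)‖ ≤ c₀ * ∑ p, (fockInner (pderiv p ξ) (pderiv p ξ)).re := by
  rw [Finset.mul_sum]
  refine norm_sum_le_of_le _ fun p _ => ?_
  by_cases hp : p ∈ Q
  · rw [norm_mul, fockInner_self_eq_re, Complex.norm_real, Real.norm_of_nonneg (fockInner_self_re_nonneg _),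
      Complex.ofReal_re]
    exact mul_le_mul_of_nonneg_right (hc p hp) (fockInner_self_re_nonneg _)
  · rw [hξ p hp, fockInner_zero_left, mul_zero, norm_zero, Complex.zero_re, mul_zero]

end CauchySchwarz

/-! ### Tools: Wick's rule flattened, reindexing, restriction to the support, CS variants -/

section Tools

variable {ι : Type*} [Fintype ι] [DecidableEq ι] {σ : ι → ι} {e : ι → Momentum}

omit [Fintype ι] [DecidableEq ι] in
/-- Annihilations commute. [folklore] -/
theorem pderiv_pderiv_comm (i j : ι) (p : MvPolynomial ι ℂ) : pderiv i (pderiv j p) = pderiv j (pderiv i p) :=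
  an_an_comm i j p

omit [Fintype ι] in
/-- Wick's rule for two creators on each side, flattened into seven indicator terms. [folklore] -/
theorem fockInner_X_mul_X_mul_X_mul_X_mul' (k l k' l' : ι) (u u' : MvPolynomial ι ℂ) :
    fockInner (X k * (X l * u)) (X k' * (X l' * u')) =
      fockInner (pderiv l' (pderiv k' u)) (pderiv l (pderiv k u')) +
      (if l = l' then fockInner (pderiv k' u) (pderiv k u') else 0) +
      (if k = l' then fockInner (pderiv k' u) (pderiv l u') else 0) +
      (if k' = l then fockInner (pderiv l' u) (pderiv k u') else 0) +
      (if k' = l ∧ k = l' then fockInner u u' else 0) +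
      (if k = k' then fockInner (pderiv l' u) (pderiv l u') else 0) +
      (if k = k' ∧ l = l' then fockInner u u' else 0) := by
  rw [fockInner_X_mul_X_mul_X_mul_X_mul]
  simp only [ite_and]
  by_cases h : k = k'
  · simp only [h, if_true]; ring
  · simp only [h, if_false, add_zero]

omit [DecidableEq ι] in
/-- Reindexing a sum along the involution. [folklore] -/
theorem sum_comp_involutive (hσ : Function.Involutive σ) {M : Type*} [AddCommMonoid M] (F : ι → M) :
    ∑ p, F (σ p) = ∑ p, F p :=
  Equiv.sum_comp (hσ.toPerm σ) F

omit [DecidableEq ι] in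
/-- Swapping two blocks of two sums with fixed ranges. [folklore] -/
theorem sum_comm₂₂ {M : Type*} [AddCommMonoid M] (f : ι → ι → ι → ι → M) :
    ∑ p, ∑ q, ∑ p', ∑ q', f p q p' q' = ∑ p', ∑ q', ∑ p, ∑ q, f p q p' q' := by
  calc ∑ p, ∑ q, ∑ p', ∑ q', f p q p' q'
      = ∑ a ∈ (Finset.univ : Finset ι) ×ˢ (Finset.univ : Finset ι),
          ∑ b ∈ (Finset.univ : Finset ι) ×ˢ (Finset.univ : Finset ι), f a.1 a.2 b.1 b.2 := by
        simp only [Finset.sum_product]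
    _ = ∑ b ∈ (Finset.univ : Finset ι) ×ˢ (Finset.univ : Finset ι),
          ∑ a ∈ (Finset.univ : Finset ι) ×ˢ (Finset.univ : Finset ι), f a.1 a.2 b.1 b.2 := Finset.sum_comm
    _ = _ := by simp only [Finset.sum_product]

/-- **Restriction of a two-body kernel to the support**: if `a_pξ = 0` off `Q`, the kernel may be
multiplied by the indicator of `Q⁴`. [folklore] -/
theorem sum_kernel_eq_sum_restrict (K : ι → ι → ι → ι → ℂ) (Q : Finset ι) (ξ : MvPolynomial ι ℂ)
    (hξ : ∀ p ∉ Q, pderiv p ξ = 0) :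
    ∑ x, ∑ y, ∑ x', ∑ y', K x y x' y' * fockInner (pderiv y (pderiv x ξ)) (pderiv y' (pderiv x' ξ)) =
      ∑ x, ∑ y, ∑ x', ∑ y', (if x ∈ Q ∧ y ∈ Q ∧ x' ∈ Q ∧ y' ∈ Q then K x y x' y' else 0) *
        fockInner (pderiv y (pderiv x ξ)) (pderiv y' (pderiv x' ξ)) := by
  refine Finset.sum_congr rfl fun x _ => Finset.sum_congr rfl fun y _ => Finset.sum_congr rfl fun x' _ =>
    Finset.sum_congr rfl fun y' _ => ?_
  by_cases h : x ∈ Q ∧ y ∈ Q ∧ x' ∈ Q ∧ y' ∈ Q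
  · rw [if_pos h]
  · rw [if_neg h, zero_mul]
    have hz : pderiv y (pderiv x ξ) = 0 ∨ pderiv y' (pderiv x' ξ) = 0 := by
      by_cases hx : x ∈ Q
      · by_cases hy : y ∈ Q
        · by_cases hx' : x' ∈ Q
          · have hy' : y' ∉ Q := fun hy' => h ⟨hx, hy, hx', hy'⟩
            right; rw [pderiv_pderiv_comm, hξ y' hy', map_zero]
          · right; rw [hξ x' hx', map_zero]
        · left; rw [pderiv_pderiv_comm, hξ y hy, map_zero]
      · left; rw [hξ x hx, map_zero]
    rcases hz with hz | hz
    · rw [hz, fockInner_zero_left, mul_zero]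
    · rw [hz, fockInner_zero_right, mul_zero]

omit [DecidableEq ι] in
/-- **Cauchy–Schwarz, `φ` on the second annihilated modes.** [folklore] -/
theorem norm_sum_kernel_fockInner_pderiv_pderiv_le' (he : Function.Injective e) (K : ι → ι → ι → ι → ℂ)
    (φ : ι → ℝ) (hφ : ∀ x, 0 ≤ φ x) {B : ℝ} (hB : 0 ≤ B)
    (hK : ∀ x y x' y', ‖K x y x' y'‖ ≤ (if e x + e y = e x' + e y' then B * (φ y * φ y') else 0))
    (ξ : MvPolynomial ι ℂ) :
    ‖∑ x, ∑ y, ∑ x', ∑ y', K x y x' y' * fockInner (pderiv y (pderiv x ξ)) (pderiv y' (pderiv x' ξ))‖ ≤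
      B * (∑ x, φ x ^ 2) * ∑ x, ∑ y, (fockInner (pderiv y (pderiv x ξ)) (pderiv y (pderiv x ξ))).re := by
  -- swap the roles of the two annihilated modes on each side
  have hre : ∑ x, ∑ y, ∑ x', ∑ y', K x y x' y' * fockInner (pderiv y (pderiv x ξ)) (pderiv y' (pderiv x' ξ)) =
      ∑ y, ∑ x, ∑ y', ∑ x', K x y x' y' * fockInner (pderiv x (pderiv y ξ)) (pderiv x' (pderiv y' ξ)) := by
    rw [Finset.sum_comm]
    refine Finset.sum_congr rfl fun y _ => Finset.sum_congr rfl fun x _ => ?_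
    rw [Finset.sum_comm]
    refine Finset.sum_congr rfl fun y' _ => Finset.sum_congr rfl fun x' _ => ?_
    rw [pderiv_pderiv_comm y x, pderiv_pderiv_comm y' x']
  rw [hre]
  have h := norm_sum_kernel_fockInner_pderiv_pderiv_le he (fun a b a' b' => K b a b' a') φ hφ hB
    (fun a b a' b' => by
      have := hK b a b' a'
      rwa [add_comm (e b) (e a), add_comm (e b') (e a')] at this) ξ
  exact h

omit [DecidableEq ι] in
/-- **A weighted number sum with the `σ`-partner**: `|∑_p c_p σ_p-weight ‖a_{σp}ξ‖²|`-type bound: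
if `|c p| ≤ c₀ w p` with `w ≥ 0`, `∑ w = S`, and `‖a_{•}ξ‖²`-weights bounded by `s` on the support,
then `‖∑_p ∑_q c(p,q) ‖a_{r q}ξ‖²‖ ≤ c₀ S s M₁` … stated concretely below where used. [folklore] -/
theorem norm_sum_sum_mul_le_of_le {c : ι → ι → ℂ} {A B : ι → ℝ}
    {c₀ : ℝ} (hc : ∀ p q, ‖c p q‖ ≤ c₀ * (A p * B q)) :
    ‖∑ p, ∑ q, c p q‖ ≤ c₀ * (∑ p, A p) * ∑ q, B q := by
  calc ‖∑ p, ∑ q, c p q‖ ≤ ∑ p, ∑ q, c₀ * (A p * B q) :=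
        norm_sum_le_of_le _ fun p _ => norm_sum_le_of_le _ fun q _ => hc p q
    _ = c₀ * (∑ p, A p) * ∑ q, B q := by
        rw [mul_assoc, Finset.sum_mul_sum, Finset.mul_sum]
        refine Finset.sum_congr rfl fun p _ => ?_
        rw [Finset.mul_sum]

/-- Collapsing a double sum on a conjunction of two equalities. [folklore] -/
theorem sum_sum_ite_and_eq {M : Type*} [AddCommMonoid M] (a b : ι) (F : ι → ι → M) :
    ∑ p', ∑ q', (if q' = a ∧ b = p' then F p' q' else 0) = F b a := by
  rw [Finset.sum_eq_single b]
  · rw [Finset.sum_eq_single a]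
    · simp
    · intro q' _ hq'; rw [if_neg (fun h => hq' h.1)]
    · intro h; exact absurd (Finset.mem_univ a) h
  · intro p' _ hp'
    exact Finset.sum_eq_zero fun q' _ => if_neg (fun h => hp' h.2.symm)
  · intro h; exact absurd (Finset.mem_univ b) h

/-- Collapsing a double sum on a conjunction of two equalities (second form). [folklore] -/
theorem sum_sum_ite_and_eq' {M : Type*} [AddCommMonoid M] (a b : ι) (F : ι → ι → M) :
    ∑ p', ∑ q', (if a = q' ∧ b = p' then F p' q' else 0) = F b a := by
  rw [← sum_sum_ite_and_eq a b F]
  refine Finset.sum_congr rfl fun p' _ => Finset.sum_congr rfl fun q' _ => ?_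
  simp only [eq_comm]

end Tools

/-! ### The `G₃` block: `∑ c σ_qσ_pσ_{q'}σ_{p'} ⟨X_{σq}X_{σp}ξ, X_{σq'}X_{σp'}ξ⟩` normal ordered -/

section G3

variable {ι : Type*} [Fintype ι] [DecidableEq ι] {σ : ι → ι} {P : Finset ι} {t : ι → ℝ} {e : ι → Momentum}

/-- **The `G₃` (pair-creation) block of `⟨B_qB_pξ, B_{q'}B_{p'}ξ⟩`, normal ordered and bounded.**
For even pair data, injective momentum labels with `e(σp) = -e(p)`, a vector `ξ` with `a_pξ = 0`
off a set `Q` on which `|σ_p| ≤ s₀`, and `|W| ≤ W₀`: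
`∑_{p,q,p',q'} c σ_qσ_pσ_{q'}σ_{p'} ⟨X_{σq}X_{σp}ξ, X_{σq'}X_{σp'}ξ⟩
  = (∑_{p,q} W(e q - e p)σ_p²σ_q² + W(0)(∑σ_p²)²)‖ξ‖² + R`,
`|R| ≤ 4W₀ (∑_pσ_p²) s₀² ∑‖a_pξ‖² + W₀ s₀² (∑_{p∈Q}σ_p²) ∑_{x,y}‖a_ya_xξ‖²` — the constant terms
of `G₃` (kept exactly) and the bound `C N^{κ-1}‖σ_S‖²_∞‖σ‖²‖(𝒩+1)ξ_ν‖²` for the rest.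
[cite: BastiCenatiempoSchlein2021, §4 (normal ordering of `G₃`, (4.G3))] -/
theorem norm_G3_sub_const_le (hσ : Function.Involutive σ) (hP : ∀ p ∈ P, σ p ∉ P)
    (he : Function.Injective e) (heσ : ∀ p, e (σ p) = -e p) (W : Momentum → ℂ) {W₀ : ℝ}
    (hW : ∀ k, ‖W k‖ ≤ W₀) (Q : Finset ι) {s₀ : ℝ} (hs₀ : 0 ≤ s₀)
    (hsQ : ∀ p ∈ Q, |bogSigma σ P t p| ≤ s₀) (ξ : MvPolynomial ι ℂ) (hξ : ∀ p ∉ Q, pderiv p ξ = 0) :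
    ‖(∑ p, ∑ q, ∑ p', ∑ q', pairCoeff' e W p q p' q' *
        ((((bogSigma σ P t q * bogSigma σ P t p * (bogSigma σ P t q' * bogSigma σ P t p')) : ℝ)) : ℂ) *
          fockInner (X (σ q) * (X (σ p) * ξ)) (X (σ q') * (X (σ p') * ξ))) -
      ((∑ p, ∑ q, W (e q - e p) * (((bogSigma σ P t p ^ 2 * bogSigma σ P t q ^ 2 : ℝ)) : ℂ)) +
        W 0 * ((((∑ p, bogSigma σ P t p ^ 2) ^ 2 : ℝ)) : ℂ)) * fockInner ξ ξ‖ ≤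
      4 * W₀ * (∑ p, bogSigma σ P t p ^ 2) * s₀ ^ 2 * ∑ p, (fockInner (pderiv p ξ) (pderiv p ξ)).re +
      W₀ * s₀ ^ 2 * (∑ p ∈ Q, bogSigma σ P t p ^ 2) *
        ∑ x, ∑ y, (fockInner (pderiv y (pderiv x ξ)) (pderiv y (pderiv x ξ))).re := by
  classical
  -- notation and basic facts
  set sg : ι → ℝ := fun p => bogSigma σ P t p with hsg
  have hsg_even : ∀ p, sg (σ p) = sg p := fun p => bogSigma_partner hσ hP p
  have hW₀ : 0 ≤ W₀ := le_trans (norm_nonneg _) (hW 0)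
  set M₁ : ℝ := ∑ p, (fockInner (pderiv p ξ) (pderiv p ξ)).re with hM₁
  set M₂ : ℝ := ∑ x, ∑ y, (fockInner (pderiv y (pderiv x ξ)) (pderiv y (pderiv x ξ))).re with hM₂
  set S2 : ℝ := ∑ p, sg p ^ 2 with hS2
  have hS20 : 0 ≤ S2 := Finset.sum_nonneg fun p _ => sq_nonneg _
  have hM₁0 : 0 ≤ M₁ := Finset.sum_nonneg fun p _ => fockInner_self_re_nonneg _
  have hsq : ∀ p ∈ Q, sg p ^ 2 ≤ s₀ ^ 2 := fun p hp => by
    rw [← sq_abs]; exact pow_le_pow_left₀ (abs_nonneg _) (hsQ p hp) 2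
  have habs : ∀ p ∈ Q, |sg p| ≤ s₀ := hsQ
  -- `sg p² ‖a_{σ p}ξ‖² ≤ s₀² ‖a_{σp}ξ‖²`
  have hsupp : ∀ p, sg p ^ 2 * (fockInner (pderiv (σ p) ξ) (pderiv (σ p) ξ)).re ≤
      s₀ ^ 2 * (fockInner (pderiv (σ p) ξ) (pderiv (σ p) ξ)).re := by
    intro p
    by_cases hp : σ p ∈ Q
    · rw [← hsg_even p]
      exact mul_le_mul_of_nonneg_right (hsq _ hp) (fockInner_self_re_nonneg _)
    · rw [hξ _ hp, fockInner_zero_left, Complex.zero_re, mul_zero, mul_zero]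
  have hM₁σ : ∑ p, (fockInner (pderiv (σ p) ξ) (pderiv (σ p) ξ)).re = M₁ :=
    sum_comp_involutive hσ (fun p => (fockInner (pderiv p ξ) (pderiv p ξ)).re)
  -- the generic number-sum bound: `‖∑_{p,q} c(p,q) sg q² sg p² ‖a_{σp}ξ‖²‖ ≤ c₀ S2 s₀² M₁`
  have hnum : ∀ (c : ι → ι → ℂ) {c₀ : ℝ}, 0 ≤ c₀ → (∀ p q, ‖c p q‖ ≤ c₀) →
      ‖∑ p, ∑ q, c p q * (((sg q ^ 2 * sg p ^ 2 : ℝ)) : ℂ) * fockInner (pderiv (σ p) ξ) (pderiv (σ p) ξ)‖ ≤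
        c₀ * S2 * s₀ ^ 2 * M₁ := by
    intro c c₀ hc₀ hc
    have h := norm_sum_sum_mul_le_of_le (c := fun p q => c p q * (((sg q ^ 2 * sg p ^ 2 : ℝ)) : ℂ) *
        fockInner (pderiv (σ p) ξ) (pderiv (σ p) ξ))
      (A := fun p => s₀ ^ 2 * (fockInner (pderiv (σ p) ξ) (pderiv (σ p) ξ)).re) (B := fun q => sg q ^ 2)
      (c₀ := c₀) (fun p q => by
        rw [norm_mul, norm_mul, fockInner_self_eq_re, Complex.norm_real, Complex.norm_real,
          Real.norm_of_nonneg (by positivity), Real.norm_of_nonneg (fockInner_self_re_nonneg _), Complex.ofReal_re]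
        calc ‖c p q‖ * (sg q ^ 2 * sg p ^ 2) * (fockInner (pderiv (σ p) ξ) (pderiv (σ p) ξ)).re
            = ‖c p q‖ * (sg q ^ 2 * (sg p ^ 2 * (fockInner (pderiv (σ p) ξ) (pderiv (σ p) ξ)).re)) := by ring
          _ ≤ c₀ * (sg q ^ 2 * (s₀ ^ 2 * (fockInner (pderiv (σ p) ξ) (pderiv (σ p) ξ)).re)) :=
              mul_le_mul (hc p q) (mul_le_mul_of_nonneg_left (hsupp p) (sq_nonneg _))
                (by have := fockInner_self_re_nonneg (pderiv (σ p) ξ); positivity) hc₀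
          _ = c₀ * (s₀ ^ 2 * (fockInner (pderiv (σ p) ξ) (pderiv (σ p) ξ)).re * sg q ^ 2) := by ring)
    refine h.trans (le_of_eq ?_)
    rw [← Finset.mul_sum, hM₁σ, hS2]
    ring
  -- abbreviations for the coefficient and the seven pieces
  set c : ι → ι → ι → ι → ℂ := fun p q p' q' => pairCoeff' e W p q p' q' with hc
  set s4 : ι → ι → ι → ι → ℂ := fun p q p' q' => (((sg q * sg p * (sg q' * sg p')) : ℝ) : ℂ) with hs4
  have hc_apply : ∀ p q p' q', c p q p' q' = if e p + e q = e p' + e q' then W (e p' - e p) else 0 :=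
    fun _ _ _ _ => rfl
  set S1 : ℂ := ∑ p, ∑ q, ∑ p', ∑ q', c p q p' q' * s4 p q p' q' *
    fockInner (pderiv (σ p') (pderiv (σ q') ξ)) (pderiv (σ p) (pderiv (σ q) ξ)) with hS1
  set S2' : ℂ := ∑ p, ∑ q, ∑ p', ∑ q', c p q p' q' * s4 p q p' q' *
    (if p = p' then fockInner (pderiv (σ q') ξ) (pderiv (σ q) ξ) else 0) with hS2'
  set S3 : ℂ := ∑ p, ∑ q, ∑ p', ∑ q', c p q p' q' * s4 p q p' q' *
    (if q = p' then fockInner (pderiv (σ q') ξ) (pderiv (σ p) ξ) else 0) with hS3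
  set S4 : ℂ := ∑ p, ∑ q, ∑ p', ∑ q', c p q p' q' * s4 p q p' q' *
    (if q' = p then fockInner (pderiv (σ p') ξ) (pderiv (σ q) ξ) else 0) with hS4
  set S5 : ℂ := ∑ p, ∑ q, ∑ p', ∑ q', c p q p' q' * s4 p q p' q' *
    (if q' = p ∧ q = p' then fockInner ξ ξ else 0) with hS5
  set S6 : ℂ := ∑ p, ∑ q, ∑ p', ∑ q', c p q p' q' * s4 p q p' q' *
    (if q = q' then fockInner (pderiv (σ p') ξ) (pderiv (σ p) ξ) else 0) with hS6
  set S7 : ℂ := ∑ p, ∑ q, ∑ p', ∑ q', c p q p' q' * s4 p q p' q' *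
    (if q = q' ∧ p = p' then fockInner ξ ξ else 0) with hS7
  -- (1) the expansion
  have hexp : (∑ p, ∑ q, ∑ p', ∑ q', pairCoeff' e W p q p' q' *
      ((((bogSigma σ P t q * bogSigma σ P t p * (bogSigma σ P t q' * bogSigma σ P t p')) : ℝ)) : ℂ) *
        fockInner (X (σ q) * (X (σ p) * ξ)) (X (σ q') * (X (σ p') * ξ))) =
      S1 + S2' + S3 + S4 + S5 + S6 + S7 := by
    simp only [hS1, hS2', hS3, hS4, hS5, hS6, hS7, ← Finset.sum_add_distrib]
    refine Finset.sum_congr rfl fun p _ => Finset.sum_congr rfl fun q _ => Finset.sum_congr rfl fun p' _ =>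
      Finset.sum_congr rfl fun q' _ => ?_
    rw [fockInner_X_mul_X_mul_X_mul_X_mul']
    simp only [hσ.injective.eq_iff, hc, hs4, hsg]
    ring
  -- (2) the two constant pieces
  have hS5v : S5 = (∑ p, ∑ q, W (e q - e p) * (((bogSigma σ P t p ^ 2 * bogSigma σ P t q ^ 2 : ℝ)) : ℂ)) *
      fockInner ξ ξ := by
    rw [hS5, Finset.sum_mul]
    refine Finset.sum_congr rfl fun p _ => ?_
    rw [Finset.sum_mul]
    refine Finset.sum_congr rfl fun q _ => ?_
    have h := sum_sum_ite_and_eq p q (fun p' q' => c p q p' q' * s4 p q p' q' * fockInner ξ ξ)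
    simp only [mul_ite, mul_zero] at h ⊢
    rw [h, hc_apply, if_pos (add_comm _ _)]
    simp only [hs4, hsg]
    push_cast; ring
  have hS7v : S7 = W 0 * ((((∑ p, bogSigma σ P t p ^ 2) ^ 2 : ℝ)) : ℂ) * fockInner ξ ξ := by
    rw [hS7]
    have h1 : ∀ p q, ∑ p', ∑ q', c p q p' q' * s4 p q p' q' * (if q = q' ∧ p = p' then fockInner ξ ξ else 0) =
        W 0 * (((sg p ^ 2 * sg q ^ 2 : ℝ)) : ℂ) * fockInner ξ ξ := by
      intro p q
      have h := sum_sum_ite_and_eq' q p (fun p' q' => c p q p' q' * s4 p q p' q' * fockInner ξ ξ)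
      simp only [mul_ite, mul_zero] at h ⊢
      rw [h, hc_apply, if_pos rfl, sub_self]
      simp only [hs4]
      push_cast; ring
    simp only [h1]
    rw [sq (∑ p, bogSigma σ P t p ^ 2), Complex.ofReal_mul, Complex.ofReal_sum, Finset.sum_mul_sum,
      Finset.mul_sum, Finset.sum_mul]
    refine Finset.sum_congr rfl fun p _ => ?_
    rw [Finset.mul_sum, Finset.sum_mul]
    refine Finset.sum_congr rfl fun q _ => ?_
    simp only [hsg]; push_cast; ring
  -- (3) the four number pieces
  have hS2b : ‖S2'‖ ≤ W₀ * S2 * s₀ ^ 2 * M₁ := by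
    have h1 : S2' = ∑ p, ∑ q, W 0 * (((sg p ^ 2 * sg q ^ 2 : ℝ)) : ℂ) * fockInner (pderiv (σ q) ξ) (pderiv (σ q) ξ) := by
      rw [hS2']
      refine Finset.sum_congr rfl fun p _ => Finset.sum_congr rfl fun q _ => ?_
      rw [Finset.sum_comm]
      simp only [mul_ite, mul_zero, Finset.sum_ite_eq, Finset.mem_univ, if_true]
      simp only [hc_apply, add_right_inj, sub_self, ite_mul, zero_mul]
      rw [sum_ite_momentum_eq he q]
      simp only [hs4]; push_cast; ring
    rw [h1, Finset.sum_comm]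
    exact hnum (fun _ _ => W 0) hW₀ (fun _ _ => hW 0)
  have hS3b : ‖S3‖ ≤ W₀ * S2 * s₀ ^ 2 * M₁ := by
    have h1 : S3 = ∑ p, ∑ q, W (e q - e p) * (((sg q ^ 2 * sg p ^ 2 : ℝ)) : ℂ) * fockInner (pderiv (σ p) ξ) (pderiv (σ p) ξ) := by
      rw [hS3]
      refine Finset.sum_congr rfl fun p _ => Finset.sum_congr rfl fun q _ => ?_
      rw [Finset.sum_comm]
      simp only [mul_ite, mul_zero, Finset.sum_ite_eq, Finset.mem_univ, if_true]
      have hiff : ∀ q', (e p + e q = e q + e q') ↔ (e p = e q') := fun q' => by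
        rw [add_comm (e q) (e q'), add_left_inj]
      simp only [hc_apply, hiff, ite_mul, zero_mul]
      rw [sum_ite_momentum_eq he p]
      simp only [hs4]; push_cast; ring
    rw [h1]
    exact hnum (fun p q => W (e q - e p)) hW₀ (fun p q => hW _)
  have hS4b : ‖S4‖ ≤ W₀ * S2 * s₀ ^ 2 * M₁ := by
    have h1 : S4 = ∑ p, ∑ q, W (e q - e p) * (((sg p ^ 2 * sg q ^ 2 : ℝ)) : ℂ) * fockInner (pderiv (σ q) ξ) (pderiv (σ q) ξ) := by
      rw [hS4]
      refine Finset.sum_congr rfl fun p _ => Finset.sum_congr rfl fun q _ => ?_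
      simp only [mul_ite, mul_zero, Finset.sum_ite_eq', Finset.mem_univ, if_true]
      have hiff : ∀ x, (e p + e q = e x + e p) ↔ (e q = e x) := fun x => by
        rw [add_comm (e x) (e p), add_right_inj]
      simp only [hc_apply, hiff, ite_mul, zero_mul]
      rw [sum_ite_momentum_eq he q]
      simp only [hs4]; push_cast; ring
    rw [h1, Finset.sum_comm]
    exact hnum (fun p q => W (e p - e q)) hW₀ (fun p q => hW _)
  have hS6b : ‖S6‖ ≤ W₀ * S2 * s₀ ^ 2 * M₁ := by
    have h1 : S6 = ∑ p, ∑ q, W 0 * (((sg q ^ 2 * sg p ^ 2 : ℝ)) : ℂ) * fockInner (pderiv (σ p) ξ) (pderiv (σ p) ξ) := by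
      rw [hS6]
      refine Finset.sum_congr rfl fun p _ => Finset.sum_congr rfl fun q _ => ?_
      simp only [mul_ite, mul_zero, Finset.sum_ite_eq, Finset.mem_univ, if_true]
      simp only [hc_apply, add_left_inj, ite_mul, zero_mul]
      rw [sum_ite_momentum_eq he p, sub_self]
      simp only [hs4]; push_cast; ring
    rw [h1]
    exact hnum (fun _ _ => W 0) hW₀ (fun _ _ => hW 0)
  -- (4) the two-body piece
  have hS1b : ‖S1‖ ≤ W₀ * s₀ ^ 2 * (∑ p ∈ Q, bogSigma σ P t p ^ 2) * M₂ := by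
    -- reindex to the Cauchy–Schwarz shape
    have hre : S1 = ∑ a, ∑ b, ∑ a', ∑ b', (c (σ a') (σ b') (σ a) (σ b) * s4 (σ a') (σ b') (σ a) (σ b)) *
        fockInner (pderiv b (pderiv a ξ)) (pderiv b' (pderiv a' ξ)) := by
      rw [hS1, sum_comm₂₂]
      rw [← sum_comp_involutive hσ]
      refine Finset.sum_congr rfl fun a _ => ?_
      rw [← sum_comp_involutive hσ]
      refine Finset.sum_congr rfl fun b _ => ?_
      rw [← sum_comp_involutive hσ]
      refine Finset.sum_congr rfl fun a' _ => ?_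
      rw [← sum_comp_involutive hσ]
      refine Finset.sum_congr rfl fun b' _ => ?_
      simp only [hσ a, hσ b, hσ a', hσ b', pderiv_pderiv_comm a b, pderiv_pderiv_comm a' b']
    rw [hre, sum_kernel_eq_sum_restrict _ Q ξ hξ]
    have hφ0 : ∀ x, 0 ≤ (if x ∈ Q then |sg x| else 0 : ℝ) := fun x => by split_ifs <;> [exact abs_nonneg _; exact le_rfl]
    have h := norm_sum_kernel_fockInner_pderiv_pderiv_le he
      (fun a b a' b' => if a ∈ Q ∧ b ∈ Q ∧ a' ∈ Q ∧ b' ∈ Q then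
        c (σ a') (σ b') (σ a) (σ b) * s4 (σ a') (σ b') (σ a) (σ b) else 0)
      (fun x => if x ∈ Q then |sg x| else 0) hφ0 (B := W₀ * s₀ ^ 2) (by positivity) ?_ ξ
    · refine h.trans (le_of_eq ?_)
      rw [hM₂]
      congr 1
      have hφ2 : ∑ x, (if x ∈ Q then |sg x| else 0 : ℝ) ^ 2 = ∑ p ∈ Q, bogSigma σ P t p ^ 2 := by
        rw [← Finset.sum_ite_mem_eq Q]
        refine Finset.sum_congr rfl fun x _ => ?_
        split_ifs <;> simp [sq_abs, hsg]
      rw [hφ2]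
    · intro a b a' b'
      by_cases hmem : a ∈ Q ∧ b ∈ Q ∧ a' ∈ Q ∧ b' ∈ Q
      · obtain ⟨ha, hb, ha', hb'⟩ := hmem
        rw [if_pos ⟨ha, hb, ha', hb'⟩, hc_apply, heσ, heσ, heσ, heσ]
        have hiff : (-e a' + -e b' = -e a + -e b) ↔ (e a + e b = e a' + e b') := by
          constructor <;> intro hh
          · linear_combination hh
          · linear_combination hh
        by_cases hm : e a + e b = e a' + e b'
        · rw [if_pos (hiff.2 hm), if_pos hm, if_pos ha, if_pos ha', norm_mul, Complex.norm_real]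
          simp only [hsg_even, Real.norm_eq_abs, abs_mul]
          have h1 := habs a ha; have h2 := habs a' ha'; have h3 := habs b hb; have h4 := habs b' hb'
          have hWn := hW (-e a + - -e a')
          calc ‖W (-e a + - -e a')‖ * (|sg b'| * |sg a'| * (|sg b| * |sg a|))
              = ‖W (-e a + - -e a')‖ * (|sg b'| * |sg b|) * (|sg a| * |sg a'|) := by ring
            _ ≤ W₀ * (s₀ * s₀) * (|sg a| * |sg a'|) := by
                refine mul_le_mul_of_nonneg_right (mul_le_mul hWn (mul_le_mul h4 h3 (abs_nonneg _) hs₀)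
                  (by positivity) hW₀) (by positivity)
            _ = W₀ * s₀ ^ 2 * (|sg a| * |sg a'|) := by ring
        · rw [if_neg (fun hh => hm (hiff.1 hh)), if_neg hm, zero_mul, norm_zero]
      · rw [if_neg hmem, norm_zero]
        split_ifs <;> first | exact le_rfl | positivity
  -- (5) assemble
  have hdiff : (∑ p, ∑ q, ∑ p', ∑ q', pairCoeff' e W p q p' q' *
      ((((bogSigma σ P t q * bogSigma σ P t p * (bogSigma σ P t q' * bogSigma σ P t p')) : ℝ)) : ℂ) *
        fockInner (X (σ q) * (X (σ p) * ξ)) (X (σ q') * (X (σ p') * ξ))) -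
      ((∑ p, ∑ q, W (e q - e p) * (((bogSigma σ P t p ^ 2 * bogSigma σ P t q ^ 2 : ℝ)) : ℂ)) +
        W 0 * ((((∑ p, bogSigma σ P t p ^ 2) ^ 2 : ℝ)) : ℂ)) * fockInner ξ ξ =
      S1 + S2' + S3 + S4 + S6 := by
    rw [hexp, add_mul, ← hS5v, ← hS7v]; ring
  rw [hdiff]
  calc ‖S1 + S2' + S3 + S4 + S6‖ ≤ ‖S1‖ + ‖S2'‖ + ‖S3‖ + ‖S4‖ + ‖S6‖ := by
        have h1 := norm_add_le (S1 + S2' + S3 + S4) S6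
        have h2 := norm_add_le (S1 + S2' + S3) S4
        have h3 := norm_add_le (S1 + S2') S3
        have h4 := norm_add_le S1 S2'
        linarith
    _ ≤ W₀ * s₀ ^ 2 * (∑ p ∈ Q, bogSigma σ P t p ^ 2) * M₂ + W₀ * S2 * s₀ ^ 2 * M₁ + W₀ * S2 * s₀ ^ 2 * M₁ +
          W₀ * S2 * s₀ ^ 2 * M₁ + W₀ * S2 * s₀ ^ 2 * M₁ := by
        gcongr
    _ = _ := by rw [hS2, hsg, hM₁, hM₂]; ring

end G3

/-! ### Counting lemmas: one index determined by momentum conservation -/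

section Counting

variable {ι : Type*} [Fintype ι] {e : ι → Momentum}

/-- `∑_{q'} [e p + e q = e p' + e q'] C ≤ C` (`C ≥ 0`). [folklore] -/
theorem sum_ite_mom_const_le (he : Function.Injective e) (p q p' : ι) {C : ℝ} (hC : 0 ≤ C) :
    ∑ q', (if e p + e q = e p' + e q' then C else 0) ≤ C := by
  have hiff : ∀ q', (e p + e q = e p' + e q') ↔ (e q' = e p + e q - e p') := fun q' => by
    constructor <;> intro h
    · rw [h]; abel
    · rw [h]; abel
  simp only [hiff]
  exact sum_ite_momentum_const_le he _ hC

/-- **`q'` determined**: `∑ [mom] F(p) G(q,p') ≤ (∑F)(∑G)` for `F, G ≥ 0`. [folklore] -/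
theorem sum4_ite_mom_le_A (he : Function.Injective e) (F : ι → ℝ) (G : ι → ι → ℝ) (hF : ∀ p, 0 ≤ F p)
    (hG : ∀ q p', 0 ≤ G q p') :
    ∑ p, ∑ q, ∑ p', ∑ q', (if e p + e q = e p' + e q' then F p * G q p' else 0) ≤
      (∑ p, F p) * ∑ q, ∑ p', G q p' := by
  calc ∑ p, ∑ q, ∑ p', ∑ q', (if e p + e q = e p' + e q' then F p * G q p' else 0)
      ≤ ∑ p, ∑ q, ∑ p', F p * G q p' :=
        Finset.sum_le_sum fun p _ => Finset.sum_le_sum fun q _ => Finset.sum_le_sum fun p' _ =>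
          sum_ite_mom_const_le he p q p' (mul_nonneg (hF p) (hG q p'))
    _ = (∑ p, F p) * ∑ q, ∑ p', G q p' := by
        rw [Finset.sum_mul]
        refine Finset.sum_congr rfl fun p _ => ?_
        rw [Finset.mul_sum]
        refine Finset.sum_congr rfl fun q _ => ?_
        rw [Finset.mul_sum]

/-- **`q` determined**: `∑ [mom] F(p') G(q',p) ≤ (∑F)(∑G)` for `F, G ≥ 0`. [folklore] -/
theorem sum4_ite_mom_le_B (he : Function.Injective e) (F : ι → ℝ) (G : ι → ι → ℝ) (hF : ∀ p, 0 ≤ F p)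
    (hG : ∀ q p', 0 ≤ G q p') :
    ∑ p, ∑ q, ∑ p', ∑ q', (if e p + e q = e p' + e q' then F p' * G q' p else 0) ≤
      (∑ p, F p) * ∑ q, ∑ p', G q p' := by
  -- move `q` innermost
  have hre : ∑ p, ∑ q, ∑ p', ∑ q', (if e p + e q = e p' + e q' then F p' * G q' p else 0) =
      ∑ p, ∑ p', ∑ q', ∑ q, (if e p + e q = e p' + e q' then F p' * G q' p else 0) := by
    refine Finset.sum_congr rfl fun p _ => ?_
    rw [Finset.sum_comm]
    refine Finset.sum_congr rfl fun p' _ => ?_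
    rw [Finset.sum_comm]
  rw [hre]
  have hiff : ∀ p q p' q', (e p + e q = e p' + e q') ↔ (e q = e p' + e q' - e p) := fun p q p' q' => by
    constructor <;> intro h
    · rw [← h]; abel
    · rw [h]; abel
  calc ∑ p, ∑ p', ∑ q', ∑ q, (if e p + e q = e p' + e q' then F p' * G q' p else 0)
      ≤ ∑ p, ∑ p', ∑ q', F p' * G q' p := by
        refine Finset.sum_le_sum fun p _ => Finset.sum_le_sum fun p' _ => Finset.sum_le_sum fun q' _ => ?_
        simp only [hiff]
        exact sum_ite_momentum_const_le he _ (mul_nonneg (hF p') (hG q' p))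
    _ = ∑ p, (∑ p', F p') * ∑ q', G q' p := by
        refine Finset.sum_congr rfl fun p _ => ?_
        rw [Finset.sum_mul_sum]
    _ = (∑ p, F p) * ∑ q, ∑ p', G q p' := by
        rw [← Finset.mul_sum, Finset.sum_comm]

/-- **`q'` determined, weight on `p'`**: `∑ [mom] G(p,q) F(p') ≤ (∑G)(∑F)` for `F, G ≥ 0`. [folklore] -/
theorem sum4_ite_mom_le_C (he : Function.Injective e) (F : ι → ℝ) (G : ι → ι → ℝ) (hF : ∀ p, 0 ≤ F p)
    (hG : ∀ p q, 0 ≤ G p q) :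
    ∑ p, ∑ q, ∑ p', ∑ q', (if e p + e q = e p' + e q' then G p q * F p' else 0) ≤
      (∑ p, ∑ q, G p q) * ∑ p, F p := by
  calc ∑ p, ∑ q, ∑ p', ∑ q', (if e p + e q = e p' + e q' then G p q * F p' else 0)
      ≤ ∑ p, ∑ q, ∑ p', G p q * F p' :=
        Finset.sum_le_sum fun p _ => Finset.sum_le_sum fun q _ => Finset.sum_le_sum fun p' _ =>
          sum_ite_mom_const_le he p q p' (mul_nonneg (hG p q) (hF p'))
    _ = (∑ p, ∑ q, G p q) * ∑ p, F p := by
        rw [Finset.sum_mul]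
        refine Finset.sum_congr rfl fun p _ => ?_
        rw [Finset.sum_mul]
        refine Finset.sum_congr rfl fun q _ => ?_
        rw [Finset.mul_sum]

/-- **`q` determined, weight on `p`**: `∑ [mom] F(p) G(p',q') ≤ (∑F)(∑G)` for `F, G ≥ 0`. [folklore] -/
theorem sum4_ite_mom_le_D (he : Function.Injective e) (F : ι → ℝ) (G : ι → ι → ℝ) (hF : ∀ p, 0 ≤ F p)
    (hG : ∀ p q, 0 ≤ G p q) :
    ∑ p, ∑ q, ∑ p', ∑ q', (if e p + e q = e p' + e q' then F p * G p' q' else 0) ≤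
      (∑ p, F p) * ∑ p, ∑ q, G p q := by
  have hre : ∑ p, ∑ q, ∑ p', ∑ q', (if e p + e q = e p' + e q' then F p * G p' q' else 0) =
      ∑ p, ∑ p', ∑ q', ∑ q, (if e p + e q = e p' + e q' then F p * G p' q' else 0) := by
    refine Finset.sum_congr rfl fun p _ => ?_
    rw [Finset.sum_comm]
    refine Finset.sum_congr rfl fun p' _ => ?_
    rw [Finset.sum_comm]
  rw [hre]
  have hiff : ∀ p q p' q', (e p + e q = e p' + e q') ↔ (e q = e p' + e q' - e p) := fun p q p' q' => by
    constructor <;> intro h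
    · rw [← h]; abel
    · rw [h]; abel
  calc ∑ p, ∑ p', ∑ q', ∑ q, (if e p + e q = e p' + e q' then F p * G p' q' else 0)
      ≤ ∑ p, ∑ p', ∑ q', F p * G p' q' := by
        refine Finset.sum_le_sum fun p _ => Finset.sum_le_sum fun p' _ => Finset.sum_le_sum fun q' _ => ?_
        simp only [hiff]
        exact sum_ite_momentum_const_le he _ (mul_nonneg (hF p) (hG p' q'))
    _ = (∑ p, F p) * ∑ p, ∑ q, G p q := by
        rw [Finset.sum_mul]
        refine Finset.sum_congr rfl fun p _ => ?_
        rw [Finset.mul_sum]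
        refine Finset.sum_congr rfl fun p' _ => ?_
        rw [Finset.mul_sum]

end Counting

/-! ### More counting: dropping the determined index in any position -/

section Drop

variable {ι : Type*} [Fintype ι] {e : ι → Momentum}

/-- Drop `q'` (determined by `p, q, p'`). [folklore] -/
theorem sum4_ite_mom_le_drop₄ (he : Function.Injective e) (H : ι → ι → ι → ℝ) (hH : ∀ p q p', 0 ≤ H p q p') :
    ∑ p, ∑ q, ∑ p', ∑ q', (if e p + e q = e p' + e q' then H p q p' else 0) ≤ ∑ p, ∑ q, ∑ p', H p q p' :=
  Finset.sum_le_sum fun p _ => Finset.sum_le_sum fun q _ => Finset.sum_le_sum fun p' _ =>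
    sum_ite_mom_const_le he p q p' (hH p q p')

/-- Drop `p'` (determined by `p, q, q'`). [folklore] -/
theorem sum4_ite_mom_le_drop₃ (he : Function.Injective e) (H : ι → ι → ι → ℝ) (hH : ∀ p q q', 0 ≤ H p q q') :
    ∑ p, ∑ q, ∑ p', ∑ q', (if e p + e q = e p' + e q' then H p q q' else 0) ≤ ∑ p, ∑ q, ∑ q', H p q q' := by
  refine Finset.sum_le_sum fun p _ => Finset.sum_le_sum fun q _ => ?_
  rw [Finset.sum_comm]
  refine Finset.sum_le_sum fun q' _ => ?_
  have hiff : ∀ p', (e p + e q = e p' + e q') ↔ (e p' = e p + e q - e q') := fun p' => by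
    constructor <;> intro h
    · rw [h]; abel
    · rw [h]; abel
  simp only [hiff]
  exact sum_ite_momentum_const_le he _ (hH p q q')

/-- Drop `q` (determined by `p, p', q'`). [folklore] -/
theorem sum4_ite_mom_le_drop₂ (he : Function.Injective e) (H : ι → ι → ι → ℝ) (hH : ∀ p p' q', 0 ≤ H p p' q') :
    ∑ p, ∑ q, ∑ p', ∑ q', (if e p + e q = e p' + e q' then H p p' q' else 0) ≤ ∑ p, ∑ p', ∑ q', H p p' q' := by
  refine Finset.sum_le_sum fun p _ => ?_
  rw [Finset.sum_comm]
  refine Finset.sum_le_sum fun p' _ => ?_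
  rw [Finset.sum_comm]
  refine Finset.sum_le_sum fun q' _ => ?_
  have hiff : ∀ q, (e p + e q = e p' + e q') ↔ (e q = e p' + e q' - e p) := fun q => by
    constructor <;> intro h
    · rw [← h]; abel
    · rw [h]; abel
  simp only [hiff]
  exact sum_ite_momentum_const_le he _ (hH p p' q')

/-- Drop `p` (determined by `q, p', q'`). [folklore] -/
theorem sum4_ite_mom_le_drop₁ (he : Function.Injective e) (H : ι → ι → ι → ℝ) (hH : ∀ q p' q', 0 ≤ H q p' q') :
    ∑ p, ∑ q, ∑ p', ∑ q', (if e p + e q = e p' + e q' then H q p' q' else 0) ≤ ∑ q, ∑ p', ∑ q', H q p' q' := by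
  rw [Finset.sum_comm]
  refine Finset.sum_le_sum fun q _ => ?_
  rw [Finset.sum_comm]
  refine Finset.sum_le_sum fun p' _ => ?_
  rw [Finset.sum_comm]
  refine Finset.sum_le_sum fun q' _ => ?_
  have hiff : ∀ p, (e p + e q = e p' + e q') ↔ (e p = e p' + e q' - e q) := fun p => by
    constructor <;> intro h
    · rw [← h]; abel
    · rw [h]; abel
  simp only [hiff]
  exact sum_ite_momentum_const_le he _ (hH q p' q')

end Drop

/-! ### The `G₂` block: `⟨Z_{qp}ξ, Z_{q'p'}ξ⟩`, `Z_{qp} = γ_qσ_p a_qa†_{σp} + σ_qγ_p a†_{σq}a_p`, normal ordered -/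

section G2

variable {ι : Type*} [Fintype ι] [DecidableEq ι] {σ : ι → ι} {P : Finset ι} {t : ι → ℝ} {e : ι → Momentum}

omit [Fintype ι] in
/-- **The pairing `⟨Z_{qp}ξ, Z_{q'p'}ξ⟩` expanded** (normal ordering of `G₂`): thirteen pieces — one
constant, four "cross" number terms, four number terms and four two-body terms.
[cite: BastiCenatiempoSchlein2021, §4 (normal ordering of `G₂`)] -/
theorem fockInner_Z_Z_expand (hσ : Function.Involutive σ) (p q p' q' : ι) (ξ : MvPolynomial ι ℂ) :
    fockInner (C ((bogGamma σ P t q * bogSigma σ P t p : ℝ) : ℂ) * pderiv q (X (σ p) * ξ) +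
        C ((bogSigma σ P t q * bogGamma σ P t p : ℝ) : ℂ) * (X (σ q) * pderiv p ξ))
      (C ((bogGamma σ P t q' * bogSigma σ P t p' : ℝ) : ℂ) * pderiv q' (X (σ p') * ξ) +
        C ((bogSigma σ P t q' * bogGamma σ P t p' : ℝ) : ℂ) * (X (σ q') * pderiv p' ξ)) =
      -- A1 A1' block
      ((bogGamma σ P t q * bogSigma σ P t p * (bogGamma σ P t q' * bogSigma σ P t p') : ℝ) : ℂ) *
        (fockInner (pderiv (σ p') (pderiv q ξ)) (pderiv (σ p) (pderiv q' ξ)) +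
          (if p = p' then fockInner (pderiv q ξ) (pderiv q' ξ) else 0) +
          (if q' = σ p' then fockInner (pderiv q ξ) (pderiv (σ p) ξ) else 0) +
          (if q = σ p then fockInner (pderiv (σ p') ξ) (pderiv q' ξ) else 0) +
          (if q = σ p then (if q' = σ p' then fockInner ξ ξ else 0) else 0)) +
      -- A1 A2' block
      ((bogGamma σ P t q * bogSigma σ P t p * (bogSigma σ P t q' * bogGamma σ P t p') : ℝ) : ℂ) *
        (fockInner (pderiv (σ q') (pderiv q ξ)) (pderiv (σ p) (pderiv p' ξ)) +
          (if p = q' then fockInner (pderiv q ξ) (pderiv p' ξ) else 0) +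
          (if q = σ p then fockInner (pderiv (σ q') ξ) (pderiv p' ξ) else 0)) +
      -- A2 A1' block
      ((bogSigma σ P t q * bogGamma σ P t p * (bogGamma σ P t q' * bogSigma σ P t p') : ℝ) : ℂ) *
        (fockInner (pderiv (σ p') (pderiv p ξ)) (pderiv (σ q) (pderiv q' ξ)) +
          (if q = p' then fockInner (pderiv p ξ) (pderiv q' ξ) else 0) +
          (if q' = σ p' then fockInner (pderiv p ξ) (pderiv (σ q) ξ) else 0)) +
      -- A2 A2' block
      ((bogSigma σ P t q * bogGamma σ P t p * (bogSigma σ P t q' * bogGamma σ P t p') : ℝ) : ℂ) *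
        (fockInner (pderiv (σ q') (pderiv p ξ)) (pderiv (σ q) (pderiv p' ξ)) +
          (if q = q' then fockInner (pderiv p ξ) (pderiv p' ξ) else 0)) := by
  rw [pderiv_X_mul, pderiv_X_mul]
  simp only [mul_add, mul_ite, mul_zero]
  simp only [fockInner_add_left, fockInner_ite_left, fockInner_C_mul_left, Complex.conj_ofReal]
  simp only [fockInner_add_right, fockInner_ite_right, fockInner_C_mul_right]
  simp only [fockInner_X_mul_X_mul]
  simp only [fockInner_X_mul_left, fockInner_X_mul_right]
  simp only [hσ.injective.eq_iff, mul_add, mul_ite, mul_zero, ite_add_zero]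
  push_cast
  ring

set_option maxHeartbeats 1000000 in
/-- **The `G₂` block of `⟨B_qB_pξ, B_{q'}B_{p'}ξ⟩`, normal ordered and bounded.** For even pair data,
injective momentum labels with `e(σp) = -e(p)`, an even `W` with `|W| ≤ W₀`, a vector `ξ` with
`a_pξ = 0` off a set `Q` on which `|γ_p| ≤ g₀` and `|γ_pσ_p| ≤ gs₀`, and the lattice quantity
`Λ ≥ ∑_p |W(k - e p)||γ_pσ_p|` (all `k`):
`∑_{p,q,p',q'} c ⟨Z_{qp}ξ, Z_{q'p'}ξ⟩ = (∑_{p,p'} W(e p' - e p) γ_pσ_pγ_{p'}σ_{p'}) ‖ξ‖² + R`,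
`|R| ≤ 4gs₀Λ ∑‖a_pξ‖² + 4W₀(∑σ²)g₀² ∑‖a_pξ‖² + 4W₀g₀²(∑σ²) ∑‖a_ya_xξ‖²` — the constant of `G₂`
kept exactly (`(1/2N)∑V̂(r)γ_pγ_{p+r}σ_pσ_{p+r}` in [ibid.]) and the bounds
`CN^{κ-1}‖γ_S‖²_∞‖σ‖²‖(𝒩+1)ξ_ν‖² + CN^{κ-1}‖γ‖_∞‖σ‖_∞[‖γ_Sσ_S‖₁ + ‖γ_H‖_∞ sup∑V̂|η|]‖𝒩^{1/2}ξ_ν‖²`.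
[cite: BastiCenatiempoSchlein2021, §4 (normal ordering of `G₂`, (4.G2))] -/
theorem norm_G2_sub_const_le (hσ : Function.Involutive σ) (hP : ∀ p ∈ P, σ p ∉ P)
    (he : Function.Injective e) (heσ : ∀ p, e (σ p) = -e p) (W : Momentum → ℂ) {W₀ : ℝ}
    (hW : ∀ k, ‖W k‖ ≤ W₀) (hWev : ∀ k, W (-k) = W k) (Q : Finset ι) {g₀ gs₀ Λ : ℝ} (hg₀ : 0 ≤ g₀)
    (hgs₀ : 0 ≤ gs₀) (hgQ : ∀ p ∈ Q, |bogGamma σ P t p| ≤ g₀)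
    (hgsQ : ∀ p ∈ Q, |bogGamma σ P t p * bogSigma σ P t p| ≤ gs₀)
    (hΛle : ∀ k, ∑ p, ‖W (k - e p)‖ * |bogGamma σ P t p * bogSigma σ P t p| ≤ Λ)
    (ξ : MvPolynomial ι ℂ) (hξ : ∀ p ∉ Q, pderiv p ξ = 0) :
    ‖(∑ p, ∑ q, ∑ p', ∑ q', pairCoeff' e W p q p' q' *
        fockInner (C ((bogGamma σ P t q * bogSigma σ P t p : ℝ) : ℂ) * pderiv q (X (σ p) * ξ) +
            C ((bogSigma σ P t q * bogGamma σ P t p : ℝ) : ℂ) * (X (σ q) * pderiv p ξ))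
          (C ((bogGamma σ P t q' * bogSigma σ P t p' : ℝ) : ℂ) * pderiv q' (X (σ p') * ξ) +
            C ((bogSigma σ P t q' * bogGamma σ P t p' : ℝ) : ℂ) * (X (σ q') * pderiv p' ξ))) -
      (∑ p, ∑ p', W (e p' - e p) *
        (((bogGamma σ P t p * bogSigma σ P t p * (bogGamma σ P t p' * bogSigma σ P t p')) : ℝ) : ℂ)) *
        fockInner ξ ξ‖ ≤
      4 * gs₀ * Λ * ∑ p, (fockInner (pderiv p ξ) (pderiv p ξ)).re +
      4 * W₀ * (∑ p, bogSigma σ P t p ^ 2) * g₀ ^ 2 * ∑ p, (fockInner (pderiv p ξ) (pderiv p ξ)).re +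
      4 * W₀ * g₀ ^ 2 * (∑ p, bogSigma σ P t p ^ 2) *
        ∑ x, ∑ y, (fockInner (pderiv y (pderiv x ξ)) (pderiv y (pderiv x ξ))).re := by
  classical
  -- notation
  set g := bogGamma σ P t with hg
  set sg := bogSigma σ P t with hsg
  have hg_even : ∀ p, g (σ p) = g p := fun p => bogGamma_partner hσ hP p
  have hsg_even : ∀ p, sg (σ p) = sg p := fun p => bogSigma_partner hσ hP p
  have hW₀ : 0 ≤ W₀ := le_trans (norm_nonneg _) (hW 0)
  have hWnorm : ∀ a b : Momentum, ‖W (a - b)‖ = ‖W (b - a)‖ := fun a b => by rw [← hWev (a - b), neg_sub]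
  set M₁ : ℝ := ∑ p, (fockInner (pderiv p ξ) (pderiv p ξ)).re with hM₁
  set M₂ : ℝ := ∑ x, ∑ y, (fockInner (pderiv y (pderiv x ξ)) (pderiv y (pderiv x ξ))).re with hM₂
  set S2 : ℝ := ∑ p, sg p ^ 2 with hS2
  have hS20 : 0 ≤ S2 := Finset.sum_nonneg fun p _ => sq_nonneg _
  have hM₁0 : 0 ≤ M₁ := Finset.sum_nonneg fun p _ => fockInner_self_re_nonneg _
  have hM₂0 : 0 ≤ M₂ := Finset.sum_nonneg fun x _ => Finset.sum_nonneg fun y _ => fockInner_self_re_nonneg _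
  -- norms of the hole vectors
  set n1 : ι → ℝ := fun p => (fockInner (pderiv p ξ) (pderiv p ξ)).re with hn1
  have hn10 : ∀ p, 0 ≤ n1 p := fun p => fockInner_self_re_nonneg _
  have hn1_off : ∀ p ∉ Q, n1 p = 0 := fun p hp => by simp only [hn1, hξ p hp, fockInner_zero_left, Complex.zero_re]
  have hn1_norm : ∀ p, ‖fockInner (pderiv p ξ) (pderiv p ξ)‖ = n1 p := fun p => by
    rw [fockInner_self_eq_re, Complex.norm_real, Real.norm_of_nonneg (fockInner_self_re_nonneg _)]
  have hM₁σ : ∑ p, n1 (σ p) = M₁ := sum_comp_involutive hσ n1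
  -- the coefficient
  set c : ι → ι → ι → ι → ℂ := fun p q p' q' => pairCoeff' e W p q p' q' with hc
  have hc_apply : ∀ p q p' q', c p q p' q' = if e p + e q = e p' + e q' then W (e p' - e p) else 0 :=
    fun _ _ _ _ => rfl
  have hc_norm : ∀ p q p' q', ‖c p q p' q'‖ ≤ (if e p + e q = e p' + e q' then W₀ else 0) := by
    intro p q p' q'; rw [hc_apply]; split_ifs <;> [exact hW _; exact le_of_eq norm_zero]
  -- the four coefficient products
  set a11 : ι → ι → ι → ι → ℂ := fun p q p' q' => ((g q * sg p * (g q' * sg p') : ℝ) : ℂ) with ha11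
  set a12 : ι → ι → ι → ι → ℂ := fun p q p' q' => ((g q * sg p * (sg q' * g p') : ℝ) : ℂ) with ha12
  set a21 : ι → ι → ι → ι → ℂ := fun p q p' q' => ((sg q * g p * (g q' * sg p') : ℝ) : ℂ) with ha21
  set a22 : ι → ι → ι → ι → ℂ := fun p q p' q' => ((sg q * g p * (sg q' * g p') : ℝ) : ℂ) with ha22
  -- the thirteen sums
  set K11 : ℂ := ∑ p, ∑ q, ∑ p', ∑ q', c p q p' q' * a11 p q p' q' *
    (if q = σ p then (if q' = σ p' then fockInner ξ ξ else 0) else 0) with hK11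
  set K12 : ℂ := ∑ p, ∑ q, ∑ p', ∑ q', c p q p' q' * a11 p q p' q' *
    (if q = σ p then fockInner (pderiv (σ p') ξ) (pderiv q' ξ) else 0) with hK12
  set K21 : ℂ := ∑ p, ∑ q, ∑ p', ∑ q', c p q p' q' * a11 p q p' q' *
    (if q' = σ p' then fockInner (pderiv q ξ) (pderiv (σ p) ξ) else 0) with hK21
  set K22n : ℂ := ∑ p, ∑ q, ∑ p', ∑ q', c p q p' q' * a11 p q p' q' *
    (if p = p' then fockInner (pderiv q ξ) (pderiv q' ξ) else 0) with hK22n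
  set K22t : ℂ := ∑ p, ∑ q, ∑ p', ∑ q', c p q p' q' * a11 p q p' q' *
    fockInner (pderiv (σ p') (pderiv q ξ)) (pderiv (σ p) (pderiv q' ξ)) with hK22t
  set K13 : ℂ := ∑ p, ∑ q, ∑ p', ∑ q', c p q p' q' * a12 p q p' q' *
    (if q = σ p then fockInner (pderiv (σ q') ξ) (pderiv p' ξ) else 0) with hK13
  set K23n : ℂ := ∑ p, ∑ q, ∑ p', ∑ q', c p q p' q' * a12 p q p' q' *
    (if p = q' then fockInner (pderiv q ξ) (pderiv p' ξ) else 0) with hK23n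
  set K23t : ℂ := ∑ p, ∑ q, ∑ p', ∑ q', c p q p' q' * a12 p q p' q' *
    fockInner (pderiv (σ q') (pderiv q ξ)) (pderiv (σ p) (pderiv p' ξ)) with hK23t
  set K31 : ℂ := ∑ p, ∑ q, ∑ p', ∑ q', c p q p' q' * a21 p q p' q' *
    (if q' = σ p' then fockInner (pderiv p ξ) (pderiv (σ q) ξ) else 0) with hK31
  set K32n : ℂ := ∑ p, ∑ q, ∑ p', ∑ q', c p q p' q' * a21 p q p' q' *
    (if q = p' then fockInner (pderiv p ξ) (pderiv q' ξ) else 0) with hK32n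
  set K32t : ℂ := ∑ p, ∑ q, ∑ p', ∑ q', c p q p' q' * a21 p q p' q' *
    fockInner (pderiv (σ p') (pderiv p ξ)) (pderiv (σ q) (pderiv q' ξ)) with hK32t
  set K33n : ℂ := ∑ p, ∑ q, ∑ p', ∑ q', c p q p' q' * a22 p q p' q' *
    (if q = q' then fockInner (pderiv p ξ) (pderiv p' ξ) else 0) with hK33n
  set K33t : ℂ := ∑ p, ∑ q, ∑ p', ∑ q', c p q p' q' * a22 p q p' q' *
    fockInner (pderiv (σ q') (pderiv p ξ)) (pderiv (σ q) (pderiv p' ξ)) with hK33t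
  -- (1) the expansion
  have hexp : (∑ p, ∑ q, ∑ p', ∑ q', pairCoeff' e W p q p' q' *
      fockInner (C ((bogGamma σ P t q * bogSigma σ P t p : ℝ) : ℂ) * pderiv q (X (σ p) * ξ) +
          C ((bogSigma σ P t q * bogGamma σ P t p : ℝ) : ℂ) * (X (σ q) * pderiv p ξ))
        (C ((bogGamma σ P t q' * bogSigma σ P t p' : ℝ) : ℂ) * pderiv q' (X (σ p') * ξ) +
          C ((bogSigma σ P t q' * bogGamma σ P t p' : ℝ) : ℂ) * (X (σ q') * pderiv p' ξ))) =
      K22t + K22n + K21 + K12 + K11 + (K23t + K23n + K13) + (K32t + K32n + K31) + (K33t + K33n) := by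
    simp only [hK11, hK12, hK21, hK22n, hK22t, hK13, hK23n, hK23t, hK31, hK32n, hK32t, hK33n, hK33t,
      ← Finset.sum_add_distrib]
    refine Finset.sum_congr rfl fun p _ => Finset.sum_congr rfl fun q _ => Finset.sum_congr rfl fun p' _ =>
      Finset.sum_congr rfl fun q' _ => ?_
    rw [fockInner_Z_Z_expand hσ]
    simp only [hc, ha11, ha12, ha21, ha22, hg, hsg]
    ring
  -- (2) the constant
  have hK11v : K11 = (∑ p, ∑ p', W (e p' - e p) *
      (((bogGamma σ P t p * bogSigma σ P t p * (bogGamma σ P t p' * bogSigma σ P t p')) : ℝ) : ℂ)) *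
      fockInner ξ ξ := by
    rw [hK11, Finset.sum_mul]
    refine Finset.sum_congr rfl fun p _ => ?_
    rw [Finset.sum_comm, Finset.sum_mul]
    refine Finset.sum_congr rfl fun p' _ => ?_
    simp only [mul_ite, mul_zero, Finset.sum_ite_irrel, Finset.sum_const_zero, Finset.sum_ite_eq',
      Finset.mem_univ, if_true]
    rw [hc_apply, if_pos (by rw [heσ, heσ, add_neg_cancel, add_neg_cancel])]
    have key : a11 p (σ p) p' (σ p') = (((g p * sg p * (g p' * sg p')) : ℝ) : ℂ) := by
      simp only [ha11, hg_even]
    rw [key]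
  -- generic weighted number-sum bound: `‖∑_{p,p'} W'(p,p') γσ_p γσ_{p'} ‖a_{v p'}ξ‖²‖ ≤ gs₀ Λ M₁`
  have hcross : ∀ (w : ι → ι → ℂ) (v : ι → ι), Function.Involutive v → (∀ p', |g p' * sg p'| = |g (v p') * sg (v p')|) →
      (∀ p', ∑ p, ‖w p p'‖ * |g p * sg p| ≤ Λ) →
      ‖∑ p, ∑ p', w p p' * (((g p * sg p * (g p' * sg p')) : ℝ) : ℂ) * fockInner (pderiv (v p') ξ) (pderiv (v p') ξ)‖ ≤
        gs₀ * Λ * M₁ := by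
    intro w v hv hgsv hwle
    rw [Finset.sum_comm]
    calc ‖∑ p', ∑ p, w p p' * (((g p * sg p * (g p' * sg p')) : ℝ) : ℂ) * fockInner (pderiv (v p') ξ) (pderiv (v p') ξ)‖
        ≤ ∑ p', ∑ p, ‖w p p'‖ * |g p * sg p| * (gs₀ * n1 (v p')) := by
          refine norm_sum_le_of_le _ fun p' _ => norm_sum_le_of_le _ fun p _ => ?_
          rw [norm_mul, norm_mul, hn1_norm, Complex.norm_real, Real.norm_eq_abs, abs_mul]
          by_cases hp' : v p' ∈ Q
          · have h1 : |g p' * sg p'| ≤ gs₀ := by rw [hgsv p']; exact hgsQ _ hp'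
            calc ‖w p p'‖ * (|g p * sg p| * |g p' * sg p'|) * n1 (v p')
                = ‖w p p'‖ * |g p * sg p| * (|g p' * sg p'| * n1 (v p')) := by ring
              _ ≤ ‖w p p'‖ * |g p * sg p| * (gs₀ * n1 (v p')) :=
                  mul_le_mul_of_nonneg_left (mul_le_mul_of_nonneg_right h1 (hn10 _)) (by positivity)
          · rw [hn1_off _ hp', mul_zero, mul_zero, mul_zero]
      _ = ∑ p', (∑ p, ‖w p p'‖ * |g p * sg p|) * (gs₀ * n1 (v p')) := by
          refine Finset.sum_congr rfl fun p' _ => ?_; rw [Finset.sum_mul]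
      _ ≤ ∑ p', Λ * (gs₀ * n1 (v p')) :=
          Finset.sum_le_sum fun p' _ => mul_le_mul_of_nonneg_right (hwle p') (by have := hn10 (v p'); positivity)
      _ = gs₀ * Λ * ∑ p', n1 (v p') := by simp only [← Finset.mul_sum]; ring
      _ = gs₀ * Λ * M₁ := by rw [sum_comp_involutive hv n1]
  -- generic number-sum bound: `‖∑_{p,q} W'(p,q) γ_q²σ_p² ‖a_qξ‖²‖ ≤ W₀ S2 g₀² M₁`
  have hnum : ∀ (w : ι → ι → ℂ), (∀ p q, ‖w p q‖ ≤ W₀) →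
      ‖∑ p, ∑ q, w p q * (((g q ^ 2 * sg p ^ 2) : ℝ) : ℂ) * fockInner (pderiv q ξ) (pderiv q ξ)‖ ≤ W₀ * S2 * g₀ ^ 2 * M₁ := by
    intro w hw
    calc ‖∑ p, ∑ q, w p q * (((g q ^ 2 * sg p ^ 2) : ℝ) : ℂ) * fockInner (pderiv q ξ) (pderiv q ξ)‖
        ≤ ∑ p, ∑ q, W₀ * (sg p ^ 2 * (g₀ ^ 2 * n1 q)) := by
          refine norm_sum_le_of_le _ fun p _ => norm_sum_le_of_le _ fun q _ => ?_
          rw [norm_mul, norm_mul, hn1_norm, Complex.norm_real, Real.norm_of_nonneg (by positivity)]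
          by_cases hq : q ∈ Q
          · have h1 : g q ^ 2 ≤ g₀ ^ 2 := by
              rw [← sq_abs]; exact pow_le_pow_left₀ (abs_nonneg _) (hgQ q hq) 2
            calc ‖w p q‖ * (g q ^ 2 * sg p ^ 2) * n1 q = ‖w p q‖ * (sg p ^ 2 * (g q ^ 2 * n1 q)) := by ring
              _ ≤ W₀ * (sg p ^ 2 * (g₀ ^ 2 * n1 q)) :=
                  mul_le_mul (hw p q) (mul_le_mul_of_nonneg_left (mul_le_mul_of_nonneg_right h1 (hn10 q))
                    (sq_nonneg _)) (by have := hn10 q; positivity) hW₀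
          · rw [hn1_off q hq, mul_zero, mul_zero, mul_zero, mul_zero]
      _ = W₀ * S2 * g₀ ^ 2 * M₁ := by
          simp only [← Finset.mul_sum, ← Finset.sum_mul, hS2, hM₁, hn1]
          ring
  -- (3) the four cross terms
  have hK12b : ‖K12‖ ≤ gs₀ * Λ * M₁ := by
    have h1 : K12 = ∑ p, ∑ p', W (e p' - e p) * (((g p * sg p * (g p' * sg p')) : ℝ) : ℂ) *
        fockInner (pderiv (σ p') ξ) (pderiv (σ p') ξ) := by
      rw [hK12]
      refine Finset.sum_congr rfl fun p _ => ?_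
      rw [Finset.sum_comm]
      refine Finset.sum_congr rfl fun p' _ => ?_
      simp only [mul_ite, mul_zero, Finset.sum_ite_irrel, Finset.sum_const_zero, Finset.sum_ite_eq',
        Finset.mem_univ, if_true]
      simp only [hc_apply, heσ, add_neg_cancel, ite_mul, zero_mul]
      rw [sum_ite_zero_eq_momentum_add he heσ p']
      have key : a11 p (σ p) p' (σ p') = (((g p * sg p * (g p' * sg p')) : ℝ) : ℂ) := by
        simp only [ha11, hg_even]
      rw [key]
    rw [h1]
    refine hcross (fun p p' => W (e p' - e p)) σ hσ (fun p' => by rw [hg_even, hsg_even]) (fun p' => ?_)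
    calc ∑ p, ‖W (e p' - e p)‖ * |g p * sg p| = ∑ p, ‖W (e p' - e p)‖ * |bogGamma σ P t p * bogSigma σ P t p| := rfl
      _ ≤ Λ := hΛle (e p')
  have hK13b : ‖K13‖ ≤ gs₀ * Λ * M₁ := by
    have h1 : K13 = ∑ p, ∑ p', W (e p' - e p) * (((g p * sg p * (g p' * sg p')) : ℝ) : ℂ) *
        fockInner (pderiv p' ξ) (pderiv p' ξ) := by
      rw [hK13]
      refine Finset.sum_congr rfl fun p _ => ?_
      rw [Finset.sum_comm]
      refine Finset.sum_congr rfl fun p' _ => ?_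
      simp only [mul_ite, mul_zero, Finset.sum_ite_irrel, Finset.sum_const_zero, Finset.sum_ite_eq',
        Finset.mem_univ, if_true]
      simp only [hc_apply, heσ, add_neg_cancel, ite_mul, zero_mul]
      rw [sum_ite_zero_eq_momentum_add he heσ p', hσ p']
      have key : a12 p (σ p) p' (σ p') = (((g p * sg p * (g p' * sg p')) : ℝ) : ℂ) := by
        simp only [ha12, hg_even, hsg_even]; push_cast; ring
      rw [key]
    rw [h1]
    exact hcross (fun p p' => W (e p' - e p)) id (fun _ => rfl) (fun p' => rfl) (fun p' => hΛle (e p'))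
  have hK21b : ‖K21‖ ≤ gs₀ * Λ * M₁ := by
    have h1 : K21 = ∑ p, ∑ p', W (e p' - e p) * (((g p * sg p * (g p' * sg p')) : ℝ) : ℂ) *
        fockInner (pderiv (σ p) ξ) (pderiv (σ p) ξ) := by
      rw [hK21]
      refine Finset.sum_congr rfl fun p _ => ?_
      simp only [mul_ite, mul_zero, Finset.sum_ite_eq', Finset.mem_univ, if_true]
      simp only [hc_apply, heσ, add_neg_cancel, ite_mul, zero_mul]
      simp only [Finset.sum_ite_irrel, Finset.sum_const_zero]
      rw [sum_ite_momentum_add_eq_zero he heσ p]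
      refine Finset.sum_congr rfl fun p' _ => ?_
      have key : a11 p (σ p) p' (σ p') = (((g p * sg p * (g p' * sg p')) : ℝ) : ℂ) := by
        simp only [ha11, hg_even]
      rw [key]
    -- swap the roles of `p` and `p'`
    have h2 : ∑ p, ∑ p', W (e p' - e p) * (((g p * sg p * (g p' * sg p')) : ℝ) : ℂ) *
        fockInner (pderiv (σ p) ξ) (pderiv (σ p) ξ) =
        ∑ p, ∑ p', W (e p - e p') * (((g p * sg p * (g p' * sg p')) : ℝ) : ℂ) *
        fockInner (pderiv (σ p') ξ) (pderiv (σ p') ξ) := by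
      rw [Finset.sum_comm]
      refine Finset.sum_congr rfl fun p _ => Finset.sum_congr rfl fun p' _ => ?_
      push_cast; ring
    rw [h1, h2]
    refine hcross (fun p p' => W (e p - e p')) σ hσ (fun p' => by rw [hg_even, hsg_even]) (fun p' => ?_)
    calc ∑ p, ‖W (e p - e p')‖ * |g p * sg p| = ∑ p, ‖W (e p' - e p)‖ * |bogGamma σ P t p * bogSigma σ P t p| :=
          Finset.sum_congr rfl fun p _ => by rw [hWnorm]
      _ ≤ Λ := hΛle (e p')
  have hK31b : ‖K31‖ ≤ gs₀ * Λ * M₁ := by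
    have h1 : K31 = ∑ p, ∑ p', W (e p' - e p) * (((g p * sg p * (g p' * sg p')) : ℝ) : ℂ) *
        fockInner (pderiv p ξ) (pderiv p ξ) := by
      rw [hK31]
      refine Finset.sum_congr rfl fun p _ => ?_
      simp only [mul_ite, mul_zero, Finset.sum_ite_eq', Finset.mem_univ, if_true]
      simp only [hc_apply, heσ, add_neg_cancel, ite_mul, zero_mul]
      simp only [Finset.sum_ite_irrel, Finset.sum_const_zero]
      rw [sum_ite_momentum_add_eq_zero he heσ p, hσ p]
      refine Finset.sum_congr rfl fun p' _ => ?_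
      have key : a21 p (σ p) p' (σ p') = (((g p * sg p * (g p' * sg p')) : ℝ) : ℂ) := by
        simp only [ha21, hg_even, hsg_even]; push_cast; ring
      rw [key]
    have h2 : ∑ p, ∑ p', W (e p' - e p) * (((g p * sg p * (g p' * sg p')) : ℝ) : ℂ) *
        fockInner (pderiv p ξ) (pderiv p ξ) =
        ∑ p, ∑ p', W (e p - e p') * (((g p * sg p * (g p' * sg p')) : ℝ) : ℂ) *
        fockInner (pderiv p' ξ) (pderiv p' ξ) := by
      rw [Finset.sum_comm]
      refine Finset.sum_congr rfl fun p _ => Finset.sum_congr rfl fun p' _ => ?_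
      push_cast; ring
    rw [h1, h2]
    refine hcross (fun p p' => W (e p - e p')) id (fun _ => rfl) (fun p' => rfl) (fun p' => ?_)
    calc ∑ p, ‖W (e p - e p')‖ * |g p * sg p| = ∑ p, ‖W (e p' - e p)‖ * |bogGamma σ P t p * bogSigma σ P t p| :=
          Finset.sum_congr rfl fun p _ => by rw [hWnorm]
      _ ≤ Λ := hΛle (e p')
  -- (4) the four number terms
  have hK22nb : ‖K22n‖ ≤ W₀ * S2 * g₀ ^ 2 * M₁ := by
    have h1 : K22n = ∑ p, ∑ q, W 0 * (((g q ^ 2 * sg p ^ 2) : ℝ) : ℂ) * fockInner (pderiv q ξ) (pderiv q ξ) := by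
      rw [hK22n]
      refine Finset.sum_congr rfl fun p _ => Finset.sum_congr rfl fun q _ => ?_
      rw [Finset.sum_comm]
      simp only [mul_ite, mul_zero, Finset.sum_ite_eq, Finset.mem_univ, if_true]
      simp only [hc_apply, add_right_inj, sub_self, ite_mul, zero_mul]
      rw [sum_ite_momentum_eq he q]
      simp only [ha11]; push_cast; ring
    rw [h1]; exact hnum (fun _ _ => W 0) (fun _ _ => hW 0)
  have hK23nb : ‖K23n‖ ≤ W₀ * S2 * g₀ ^ 2 * M₁ := by
    have h1 : K23n = ∑ p, ∑ q, W (e q - e p) * (((g q ^ 2 * sg p ^ 2) : ℝ) : ℂ) * fockInner (pderiv q ξ) (pderiv q ξ) := by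
      rw [hK23n]
      refine Finset.sum_congr rfl fun p _ => Finset.sum_congr rfl fun q _ => ?_
      simp only [mul_ite, mul_zero, Finset.sum_ite_eq, Finset.mem_univ, if_true]
      have hiff : ∀ x, (e p + e q = e x + e p) ↔ (e q = e x) := fun x => by
        rw [add_comm (e x) (e p), add_right_inj]
      simp only [hc_apply, hiff, ite_mul, zero_mul]
      rw [sum_ite_momentum_eq he q]
      simp only [ha12]; push_cast; ring
    rw [h1]; exact hnum (fun p q => W (e q - e p)) (fun _ _ => hW _)
  have hK32nb : ‖K32n‖ ≤ W₀ * S2 * g₀ ^ 2 * M₁ := by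
    have h1 : K32n = ∑ p, ∑ q, W (e q - e p) * (((g p ^ 2 * sg q ^ 2) : ℝ) : ℂ) * fockInner (pderiv p ξ) (pderiv p ξ) := by
      rw [hK32n]
      refine Finset.sum_congr rfl fun p _ => Finset.sum_congr rfl fun q _ => ?_
      simp only [mul_ite, mul_zero, Finset.sum_ite_irrel, Finset.sum_const_zero, Finset.sum_ite_eq,
        Finset.mem_univ, if_true]
      have hiff : ∀ x, (e p + e q = e q + e x) ↔ (e p = e x) := fun x => by
        rw [add_comm (e q) (e x), add_left_inj]
      simp only [hc_apply, hiff, ite_mul, zero_mul]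
      rw [sum_ite_momentum_eq he p]
      simp only [ha21]; push_cast; ring
    rw [h1, Finset.sum_comm]; exact hnum (fun p q => W (e p - e q)) (fun _ _ => hW _)
  have hK33nb : ‖K33n‖ ≤ W₀ * S2 * g₀ ^ 2 * M₁ := by
    have h1 : K33n = ∑ p, ∑ q, W 0 * (((g p ^ 2 * sg q ^ 2) : ℝ) : ℂ) * fockInner (pderiv p ξ) (pderiv p ξ) := by
      rw [hK33n]
      refine Finset.sum_congr rfl fun p _ => Finset.sum_congr rfl fun q _ => ?_
      simp only [mul_ite, mul_zero, Finset.sum_ite_eq, Finset.mem_univ, if_true]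
      simp only [hc_apply, add_left_inj, ite_mul, zero_mul]
      rw [sum_ite_momentum_eq he p, sub_self]
      simp only [ha22]; push_cast; ring
    rw [h1, Finset.sum_comm]; exact hnum (fun _ _ => W 0) (fun _ _ => hW 0)
  -- (5) the four two-body terms
  have hnL : ∀ (x y : ι), 0 ≤ (fockInner (pderiv y (pderiv x ξ)) (pderiv y (pderiv x ξ))).re :=
    fun x y => fockInner_self_re_nonneg _
  have hvanish : ∀ (x y : ι), x ∉ Q → pderiv y (pderiv x ξ) = 0 := fun x y hx => by rw [hξ x hx, map_zero]
  -- termwise AM-GM: `‖c (γ₁s₁γ₂s₂) ⟨L,R⟩‖ ≤ [mom] W₀ g₀² (s₁²‖L‖² + s₂²‖R‖²)/2`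
  have hterm : ∀ (cc : ℂ) (γ₁ γ₂ s₁ s₂ : ℝ) (L R : MvPolynomial ι ℂ),
      ‖cc‖ ≤ W₀ → (L ≠ 0 → |γ₁| ≤ g₀) → (R ≠ 0 → |γ₂| ≤ g₀) →
      ‖cc * (((γ₁ * s₁ * (γ₂ * s₂)) : ℝ) : ℂ) * fockInner L R‖ ≤
        W₀ * g₀ ^ 2 * ((s₁ ^ 2 * (fockInner L L).re + s₂ ^ 2 * (fockInner R R).re) / 2) := by
    intro cc γ₁ γ₂ s₁ s₂ L R hcc hL hR
    have hLL := fockInner_self_re_nonneg L; have hRR := fockInner_self_re_nonneg R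
    by_cases hL0 : L = 0
    · rw [hL0, fockInner_zero_left, mul_zero, norm_zero]
      have := fockInner_self_re_nonneg (0 : MvPolynomial ι ℂ); positivity
    by_cases hR0 : R = 0
    · rw [hR0, fockInner_zero_right, mul_zero, norm_zero]
      have := fockInner_self_re_nonneg (0 : MvPolynomial ι ℂ); positivity
    have h1 := hL hL0; have h2 := hR hR0
    rw [norm_mul, norm_mul, Complex.norm_real, Real.norm_eq_abs]
    have hcs := norm_fockInner_le_sqrt_mul_sqrt L R
    set l := Real.sqrt (fockInner L L).re with hl
    set r := Real.sqrt (fockInner R R).re with hr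
    have hl2 : l ^ 2 = (fockInner L L).re := Real.sq_sqrt hLL
    have hr2 : r ^ 2 = (fockInner R R).re := Real.sq_sqrt hRR
    have hl0 : 0 ≤ l := Real.sqrt_nonneg _
    have hr0 : 0 ≤ r := Real.sqrt_nonneg _
    rw [← hl2, ← hr2]
    have hamgm : |s₁ * s₂| * (l * r) ≤ (s₁ ^ 2 * l ^ 2 + s₂ ^ 2 * r ^ 2) / 2 := by
      rw [abs_mul]
      nlinarith [sq_nonneg (|s₁| * l - |s₂| * r), abs_nonneg s₁, abs_nonneg s₂, sq_abs s₁, sq_abs s₂]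
    have hγ : |γ₁ * γ₂| ≤ g₀ ^ 2 := by
      rw [abs_mul, sq]; exact mul_le_mul h1 h2 (abs_nonneg _) hg₀
    have step1 : |s₁ * s₂| * ‖fockInner L R‖ ≤ (s₁ ^ 2 * l ^ 2 + s₂ ^ 2 * r ^ 2) / 2 :=
      (mul_le_mul_of_nonneg_left hcs (abs_nonneg _)).trans hamgm
    have hpos1 : 0 ≤ |s₁ * s₂| * ‖fockInner L R‖ := mul_nonneg (abs_nonneg _) (norm_nonneg _)
    have step2 : |γ₁ * γ₂| * (|s₁ * s₂| * ‖fockInner L R‖) ≤ g₀ ^ 2 * ((s₁ ^ 2 * l ^ 2 + s₂ ^ 2 * r ^ 2) / 2) :=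
      mul_le_mul hγ step1 hpos1 (sq_nonneg _)
    have hpos2 : 0 ≤ |γ₁ * γ₂| * (|s₁ * s₂| * ‖fockInner L R‖) := mul_nonneg (abs_nonneg _) hpos1
    have step3 : ‖cc‖ * (|γ₁ * γ₂| * (|s₁ * s₂| * ‖fockInner L R‖)) ≤
        W₀ * (g₀ ^ 2 * ((s₁ ^ 2 * l ^ 2 + s₂ ^ 2 * r ^ 2) / 2)) := mul_le_mul hcc step2 hpos2 hW₀
    have hre : ‖cc‖ * |γ₁ * s₁ * (γ₂ * s₂)| * ‖fockInner L R‖ = ‖cc‖ * (|γ₁ * γ₂| * (|s₁ * s₂| * ‖fockInner L R‖)) := by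
      rw [show γ₁ * s₁ * (γ₂ * s₂) = (γ₁ * γ₂) * (s₁ * s₂) by ring, abs_mul]; ring
    rw [hre]
    refine step3.trans (le_of_eq ?_)
    ring
  -- `M₂` with one annihilated mode reindexed along `σ`
  have hM2_inner : ∀ a, ∑ b, (fockInner (pderiv (σ b) (pderiv a ξ)) (pderiv (σ b) (pderiv a ξ))).re =
      ∑ y, (fockInner (pderiv y (pderiv a ξ)) (pderiv y (pderiv a ξ))).re :=
    fun a => sum_comp_involutive hσ (fun y => (fockInner (pderiv y (pderiv a ξ)) (pderiv y (pderiv a ξ))).re)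
  have hM2_inner_sum : ∑ a, ∑ b, (fockInner (pderiv (σ b) (pderiv a ξ)) (pderiv (σ b) (pderiv a ξ))).re = M₂ := by
    rw [hM₂]; exact Finset.sum_congr rfl fun a _ => hM2_inner a
  have hM2_outer_sum : ∑ a, ∑ b, (fockInner (pderiv (σ a) (pderiv b ξ)) (pderiv (σ a) (pderiv b ξ))).re = M₂ := by
    rw [sum_comp_involutive hσ (fun y => ∑ b, (fockInner (pderiv y (pderiv b ξ)) (pderiv y (pderiv b ξ))).re),
      Finset.sum_comm, hM₂]
  -- the generic two-body bound: `LHS ≤ W₀ g₀² /2 (Σ[mom] s₁²‖L‖² + Σ[mom] s₂²‖R‖²)`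
  have htwo : ∀ (aa : ι → ι → ι → ι → ℂ) (γ₁ γ₂ s₁ s₂ : ι → ι → ι → ι → ℝ)
      (L R : ι → ι → ι → ι → MvPolynomial ι ℂ),
      (∀ p q p' q', aa p q p' q' = (((γ₁ p q p' q' * s₁ p q p' q' * (γ₂ p q p' q' * s₂ p q p' q')) : ℝ) : ℂ)) →
      (∀ p q p' q', L p q p' q' ≠ 0 → |γ₁ p q p' q'| ≤ g₀) → (∀ p q p' q', R p q p' q' ≠ 0 → |γ₂ p q p' q'| ≤ g₀) →
      ‖∑ p, ∑ q, ∑ p', ∑ q', c p q p' q' * aa p q p' q' * fockInner (L p q p' q') (R p q p' q')‖ ≤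
        W₀ * g₀ ^ 2 / 2 * ((∑ p, ∑ q, ∑ p', ∑ q', (if e p + e q = e p' + e q' then
            s₁ p q p' q' ^ 2 * (fockInner (L p q p' q') (L p q p' q')).re else 0)) +
          ∑ p, ∑ q, ∑ p', ∑ q', (if e p + e q = e p' + e q' then
            s₂ p q p' q' ^ 2 * (fockInner (R p q p' q') (R p q p' q')).re else 0)) := by
    intro aa γ₁ γ₂ s₁ s₂ L R haa hL hR
    calc ‖∑ p, ∑ q, ∑ p', ∑ q', c p q p' q' * aa p q p' q' * fockInner (L p q p' q') (R p q p' q')‖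
        ≤ ∑ p, ∑ q, ∑ p', ∑ q', (if e p + e q = e p' + e q' then W₀ * g₀ ^ 2 *
            ((s₁ p q p' q' ^ 2 * (fockInner (L p q p' q') (L p q p' q')).re +
              s₂ p q p' q' ^ 2 * (fockInner (R p q p' q') (R p q p' q')).re) / 2) else 0) := by
          refine norm_sum_le_of_le _ fun p _ => norm_sum_le_of_le _ fun q _ => norm_sum_le_of_le _ fun p' _ =>
            norm_sum_le_of_le _ fun q' _ => ?_
          by_cases hm : e p + e q = e p' + e q'
          · rw [if_pos hm, haa]
            exact hterm _ _ _ _ _ _ _ ((hc_norm p q p' q').trans (by rw [if_pos hm])) (hL p q p' q') (hR p q p' q')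
          · have h0 : c p q p' q' = 0 := by rw [hc_apply, if_neg hm]
            rw [h0, zero_mul, zero_mul, norm_zero, if_neg hm]
      _ = _ := by
          rw [← Finset.sum_add_distrib, Finset.mul_sum]
          refine Finset.sum_congr rfl fun p _ => ?_
          rw [← Finset.sum_add_distrib, Finset.mul_sum]
          refine Finset.sum_congr rfl fun q _ => ?_
          rw [← Finset.sum_add_distrib, Finset.mul_sum]
          refine Finset.sum_congr rfl fun p' _ => ?_
          rw [← Finset.sum_add_distrib, Finset.mul_sum]
          refine Finset.sum_congr rfl fun q' _ => ?_
          split_ifs <;> ring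
  have hgL : ∀ (x y : ι), pderiv y (pderiv x ξ) ≠ 0 → |g x| ≤ g₀ := fun x y h =>
    hgQ x (by by_contra hx; exact h (hvanish x y hx))
  have hK22tb : ‖K22t‖ ≤ W₀ * g₀ ^ 2 * S2 * M₂ := by
    rw [hK22t]
    refine (htwo a11 (fun p q p' q' => g q) (fun p q p' q' => g q') (fun p q p' q' => sg p) (fun p q p' q' => sg p')
      (fun p q p' q' => pderiv (σ p') (pderiv q ξ)) (fun p q p' q' => pderiv (σ p) (pderiv q' ξ))
      (fun p q p' q' => by simp only [ha11]) (fun p q p' q' h => hgL q _ h) (fun p q p' q' h => hgL q' _ h)).trans ?_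
    have h1 := sum4_ite_mom_le_drop₄ he (fun p q p' => sg p ^ 2 *
      (fockInner (pderiv (σ p') (pderiv q ξ)) (pderiv (σ p') (pderiv q ξ))).re)
      (fun p q p' => mul_nonneg (sq_nonneg _) (hnL _ _))
    have h2 := sum4_ite_mom_le_drop₂ he (fun p p' q' => sg p' ^ 2 *
      (fockInner (pderiv (σ p) (pderiv q' ξ)) (pderiv (σ p) (pderiv q' ξ))).re)
      (fun p p' q' => mul_nonneg (sq_nonneg _) (hnL _ _))
    have e1 : ∑ p, ∑ q, ∑ p', sg p ^ 2 * (fockInner (pderiv (σ p') (pderiv q ξ)) (pderiv (σ p') (pderiv q ξ))).re =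
        S2 * M₂ := by
      rw [hS2, Finset.sum_mul]
      refine Finset.sum_congr rfl fun p _ => ?_
      rw [← hM2_inner_sum, Finset.mul_sum]
      refine Finset.sum_congr rfl fun q _ => ?_
      rw [Finset.mul_sum]
    have e2 : ∑ p, ∑ p', ∑ q', sg p' ^ 2 * (fockInner (pderiv (σ p) (pderiv q' ξ)) (pderiv (σ p) (pderiv q' ξ))).re =
        S2 * M₂ := by
      calc ∑ p, ∑ p', ∑ q', sg p' ^ 2 * (fockInner (pderiv (σ p) (pderiv q' ξ)) (pderiv (σ p) (pderiv q' ξ))).re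
          = ∑ p, S2 * ∑ q', (fockInner (pderiv (σ p) (pderiv q' ξ)) (pderiv (σ p) (pderiv q' ξ))).re := by
            refine Finset.sum_congr rfl fun p _ => ?_
            rw [hS2, Finset.sum_mul_sum]
        _ = S2 * M₂ := by rw [← Finset.mul_sum, hM2_outer_sum]
    calc W₀ * g₀ ^ 2 / 2 * ((∑ p, ∑ q, ∑ p', ∑ q', (if e p + e q = e p' + e q' then
            sg p ^ 2 * (fockInner (pderiv (σ p') (pderiv q ξ)) (pderiv (σ p') (pderiv q ξ))).re else 0)) +
          ∑ p, ∑ q, ∑ p', ∑ q', (if e p + e q = e p' + e q' then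
            sg p' ^ 2 * (fockInner (pderiv (σ p) (pderiv q' ξ)) (pderiv (σ p) (pderiv q' ξ))).re else 0))
        ≤ W₀ * g₀ ^ 2 / 2 * (S2 * M₂ + S2 * M₂) :=
          mul_le_mul_of_nonneg_left (add_le_add (h1.trans (le_of_eq e1)) (h2.trans (le_of_eq e2))) (by positivity)
      _ = W₀ * g₀ ^ 2 * S2 * M₂ := by ring
  have hK23tb : ‖K23t‖ ≤ W₀ * g₀ ^ 2 * S2 * M₂ := by
    rw [hK23t]
    refine (htwo a12 (fun p q p' q' => g q) (fun p q p' q' => g p') (fun p q p' q' => sg p) (fun p q p' q' => sg q')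
      (fun p q p' q' => pderiv (σ q') (pderiv q ξ)) (fun p q p' q' => pderiv (σ p) (pderiv p' ξ))
      (fun p q p' q' => by simp only [ha12]; push_cast; ring) (fun p q p' q' h => hgL q _ h)
      (fun p q p' q' h => hgL p' _ h)).trans ?_
    have h1 := sum4_ite_mom_le_drop₃ he (fun p q q' => sg p ^ 2 *
      (fockInner (pderiv (σ q') (pderiv q ξ)) (pderiv (σ q') (pderiv q ξ))).re)
      (fun p q q' => mul_nonneg (sq_nonneg _) (hnL _ _))
    have h2 := sum4_ite_mom_le_drop₂ he (fun p p' q' => sg q' ^ 2 *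
      (fockInner (pderiv (σ p) (pderiv p' ξ)) (pderiv (σ p) (pderiv p' ξ))).re)
      (fun p p' q' => mul_nonneg (sq_nonneg _) (hnL _ _))
    have e1 : ∑ p, ∑ q, ∑ q', sg p ^ 2 * (fockInner (pderiv (σ q') (pderiv q ξ)) (pderiv (σ q') (pderiv q ξ))).re =
        S2 * M₂ := by
      rw [hS2, Finset.sum_mul]
      refine Finset.sum_congr rfl fun p _ => ?_
      rw [← hM2_inner_sum, Finset.mul_sum]
      refine Finset.sum_congr rfl fun q _ => ?_
      rw [Finset.mul_sum]
    have e2 : ∑ p, ∑ p', ∑ q', sg q' ^ 2 * (fockInner (pderiv (σ p) (pderiv p' ξ)) (pderiv (σ p) (pderiv p' ξ))).re =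
        S2 * M₂ := by
      calc ∑ p, ∑ p', ∑ q', sg q' ^ 2 * (fockInner (pderiv (σ p) (pderiv p' ξ)) (pderiv (σ p) (pderiv p' ξ))).re
          = ∑ p, ∑ p', (fockInner (pderiv (σ p) (pderiv p' ξ)) (pderiv (σ p) (pderiv p' ξ))).re * S2 := by
            refine Finset.sum_congr rfl fun p _ => Finset.sum_congr rfl fun p' _ => ?_
            rw [hS2, Finset.mul_sum]
            exact Finset.sum_congr rfl fun q' _ => by ring
        _ = S2 * M₂ := by simp only [← Finset.sum_mul]; rw [hM2_outer_sum, mul_comm]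
    calc W₀ * g₀ ^ 2 / 2 * ((∑ p, ∑ q, ∑ p', ∑ q', (if e p + e q = e p' + e q' then
            sg p ^ 2 * (fockInner (pderiv (σ q') (pderiv q ξ)) (pderiv (σ q') (pderiv q ξ))).re else 0)) +
          ∑ p, ∑ q, ∑ p', ∑ q', (if e p + e q = e p' + e q' then
            sg q' ^ 2 * (fockInner (pderiv (σ p) (pderiv p' ξ)) (pderiv (σ p) (pderiv p' ξ))).re else 0))
        ≤ W₀ * g₀ ^ 2 / 2 * (S2 * M₂ + S2 * M₂) :=
          mul_le_mul_of_nonneg_left (add_le_add (h1.trans (le_of_eq e1)) (h2.trans (le_of_eq e2))) (by positivity)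
      _ = W₀ * g₀ ^ 2 * S2 * M₂ := by ring
  have hK32tb : ‖K32t‖ ≤ W₀ * g₀ ^ 2 * S2 * M₂ := by
    rw [hK32t]
    refine (htwo a21 (fun p q p' q' => g p) (fun p q p' q' => g q') (fun p q p' q' => sg q) (fun p q p' q' => sg p')
      (fun p q p' q' => pderiv (σ p') (pderiv p ξ)) (fun p q p' q' => pderiv (σ q) (pderiv q' ξ))
      (fun p q p' q' => by simp only [ha21]; push_cast; ring) (fun p q p' q' h => hgL p _ h)
      (fun p q p' q' h => hgL q' _ h)).trans ?_
    have h1 := sum4_ite_mom_le_drop₄ he (fun p q p' => sg q ^ 2 *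
      (fockInner (pderiv (σ p') (pderiv p ξ)) (pderiv (σ p') (pderiv p ξ))).re)
      (fun p q p' => mul_nonneg (sq_nonneg _) (hnL _ _))
    have h2 := sum4_ite_mom_le_drop₁ he (fun q p' q' => sg p' ^ 2 *
      (fockInner (pderiv (σ q) (pderiv q' ξ)) (pderiv (σ q) (pderiv q' ξ))).re)
      (fun q p' q' => mul_nonneg (sq_nonneg _) (hnL _ _))
    have e1 : ∑ p, ∑ q, ∑ p', sg q ^ 2 * (fockInner (pderiv (σ p') (pderiv p ξ)) (pderiv (σ p') (pderiv p ξ))).re =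
        S2 * M₂ := by
      calc ∑ p, ∑ q, ∑ p', sg q ^ 2 * (fockInner (pderiv (σ p') (pderiv p ξ)) (pderiv (σ p') (pderiv p ξ))).re
          = ∑ p, S2 * ∑ p', (fockInner (pderiv (σ p') (pderiv p ξ)) (pderiv (σ p') (pderiv p ξ))).re := by
            refine Finset.sum_congr rfl fun p _ => ?_
            rw [hS2, Finset.sum_mul_sum]
        _ = S2 * M₂ := by rw [← Finset.mul_sum, hM2_inner_sum]
    have e2 : ∑ q, ∑ p', ∑ q', sg p' ^ 2 * (fockInner (pderiv (σ q) (pderiv q' ξ)) (pderiv (σ q) (pderiv q' ξ))).re =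
        S2 * M₂ := by
      calc ∑ q, ∑ p', ∑ q', sg p' ^ 2 * (fockInner (pderiv (σ q) (pderiv q' ξ)) (pderiv (σ q) (pderiv q' ξ))).re
          = ∑ q, S2 * ∑ q', (fockInner (pderiv (σ q) (pderiv q' ξ)) (pderiv (σ q) (pderiv q' ξ))).re := by
            refine Finset.sum_congr rfl fun q _ => ?_
            rw [hS2, Finset.sum_mul_sum]
        _ = S2 * M₂ := by rw [← Finset.mul_sum, hM2_outer_sum]
    calc W₀ * g₀ ^ 2 / 2 * ((∑ p, ∑ q, ∑ p', ∑ q', (if e p + e q = e p' + e q' then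
            sg q ^ 2 * (fockInner (pderiv (σ p') (pderiv p ξ)) (pderiv (σ p') (pderiv p ξ))).re else 0)) +
          ∑ p, ∑ q, ∑ p', ∑ q', (if e p + e q = e p' + e q' then
            sg p' ^ 2 * (fockInner (pderiv (σ q) (pderiv q' ξ)) (pderiv (σ q) (pderiv q' ξ))).re else 0))
        ≤ W₀ * g₀ ^ 2 / 2 * (S2 * M₂ + S2 * M₂) :=
          mul_le_mul_of_nonneg_left (add_le_add (h1.trans (le_of_eq e1)) (h2.trans (le_of_eq e2))) (by positivity)
      _ = W₀ * g₀ ^ 2 * S2 * M₂ := by ring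
  have hK33tb : ‖K33t‖ ≤ W₀ * g₀ ^ 2 * S2 * M₂ := by
    rw [hK33t]
    refine (htwo a22 (fun p q p' q' => g p) (fun p q p' q' => g p') (fun p q p' q' => sg q) (fun p q p' q' => sg q')
      (fun p q p' q' => pderiv (σ q') (pderiv p ξ)) (fun p q p' q' => pderiv (σ q) (pderiv p' ξ))
      (fun p q p' q' => by simp only [ha22]; push_cast; ring) (fun p q p' q' h => hgL p _ h)
      (fun p q p' q' h => hgL p' _ h)).trans ?_
    have h1 := sum4_ite_mom_le_drop₃ he (fun p q q' => sg q ^ 2 *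
      (fockInner (pderiv (σ q') (pderiv p ξ)) (pderiv (σ q') (pderiv p ξ))).re)
      (fun p q q' => mul_nonneg (sq_nonneg _) (hnL _ _))
    have h2 := sum4_ite_mom_le_drop₁ he (fun q p' q' => sg q' ^ 2 *
      (fockInner (pderiv (σ q) (pderiv p' ξ)) (pderiv (σ q) (pderiv p' ξ))).re)
      (fun q p' q' => mul_nonneg (sq_nonneg _) (hnL _ _))
    have e1 : ∑ p, ∑ q, ∑ q', sg q ^ 2 * (fockInner (pderiv (σ q') (pderiv p ξ)) (pderiv (σ q') (pderiv p ξ))).re =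
        S2 * M₂ := by
      calc ∑ p, ∑ q, ∑ q', sg q ^ 2 * (fockInner (pderiv (σ q') (pderiv p ξ)) (pderiv (σ q') (pderiv p ξ))).re
          = ∑ p, S2 * ∑ q', (fockInner (pderiv (σ q') (pderiv p ξ)) (pderiv (σ q') (pderiv p ξ))).re := by
            refine Finset.sum_congr rfl fun p _ => ?_
            rw [hS2, Finset.sum_mul_sum]
        _ = S2 * M₂ := by rw [← Finset.mul_sum, hM2_inner_sum]
    have e2 : ∑ q, ∑ p', ∑ q', sg q' ^ 2 * (fockInner (pderiv (σ q) (pderiv p' ξ)) (pderiv (σ q) (pderiv p' ξ))).re =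
        S2 * M₂ := by
      calc ∑ q, ∑ p', ∑ q', sg q' ^ 2 * (fockInner (pderiv (σ q) (pderiv p' ξ)) (pderiv (σ q) (pderiv p' ξ))).re
          = ∑ q, ∑ p', (fockInner (pderiv (σ q) (pderiv p' ξ)) (pderiv (σ q) (pderiv p' ξ))).re * S2 := by
            refine Finset.sum_congr rfl fun q _ => Finset.sum_congr rfl fun p' _ => ?_
            rw [hS2, Finset.mul_sum]
            exact Finset.sum_congr rfl fun q' _ => by ring
        _ = S2 * M₂ := by simp only [← Finset.sum_mul]; rw [hM2_outer_sum, mul_comm]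
    calc W₀ * g₀ ^ 2 / 2 * ((∑ p, ∑ q, ∑ p', ∑ q', (if e p + e q = e p' + e q' then
            sg q ^ 2 * (fockInner (pderiv (σ q') (pderiv p ξ)) (pderiv (σ q') (pderiv p ξ))).re else 0)) +
          ∑ p, ∑ q, ∑ p', ∑ q', (if e p + e q = e p' + e q' then
            sg q' ^ 2 * (fockInner (pderiv (σ q) (pderiv p' ξ)) (pderiv (σ q) (pderiv p' ξ))).re else 0))
        ≤ W₀ * g₀ ^ 2 / 2 * (S2 * M₂ + S2 * M₂) :=
          mul_le_mul_of_nonneg_left (add_le_add (h1.trans (le_of_eq e1)) (h2.trans (le_of_eq e2))) (by positivity)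
      _ = W₀ * g₀ ^ 2 * S2 * M₂ := by ring
  -- (6) assemble
  have hdiff : (∑ p, ∑ q, ∑ p', ∑ q', pairCoeff' e W p q p' q' *
      fockInner (C ((bogGamma σ P t q * bogSigma σ P t p : ℝ) : ℂ) * pderiv q (X (σ p) * ξ) +
          C ((bogSigma σ P t q * bogGamma σ P t p : ℝ) : ℂ) * (X (σ q) * pderiv p ξ))
        (C ((bogGamma σ P t q' * bogSigma σ P t p' : ℝ) : ℂ) * pderiv q' (X (σ p') * ξ) +
          C ((bogSigma σ P t q' * bogGamma σ P t p' : ℝ) : ℂ) * (X (σ q') * pderiv p' ξ))) -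
      (∑ p, ∑ p', W (e p' - e p) *
        (((bogGamma σ P t p * bogSigma σ P t p * (bogGamma σ P t p' * bogSigma σ P t p')) : ℝ) : ℂ)) *
        fockInner ξ ξ =
      (K12 + K13 + K21 + K31) + (K22n + K23n + K32n + K33n) + (K22t + K23t + K32t + K33t) := by
    rw [hexp, ← hK11v]; ring
  rw [hdiff]
  have hA : ‖K12 + K13 + K21 + K31‖ ≤ 4 * (gs₀ * Λ * M₁) := by
    have := norm_add_le (K12 + K13 + K21) K31; have := norm_add_le (K12 + K13) K21; have := norm_add_le K12 K13
    linarith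
  have hB : ‖K22n + K23n + K32n + K33n‖ ≤ 4 * (W₀ * S2 * g₀ ^ 2 * M₁) := by
    have := norm_add_le (K22n + K23n + K32n) K33n; have := norm_add_le (K22n + K23n) K32n
    have := norm_add_le K22n K23n
    linarith
  have hC : ‖K22t + K23t + K32t + K33t‖ ≤ 4 * (W₀ * g₀ ^ 2 * S2 * M₂) := by
    have := norm_add_le (K22t + K23t + K32t) K33t; have := norm_add_le (K22t + K23t) K32t
    have := norm_add_le K22t K23t
    linarith
  have h1 := norm_add_le ((K12 + K13 + K21 + K31) + (K22n + K23n + K32n + K33n)) (K22t + K23t + K32t + K33t)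
  have h2 := norm_add_le (K12 + K13 + K21 + K31) (K22n + K23n + K32n + K33n)
  have hfin : ‖(K12 + K13 + K21 + K31) + (K22n + K23n + K32n + K33n) + (K22t + K23t + K32t + K33t)‖ ≤
      4 * (gs₀ * Λ * M₁) + 4 * (W₀ * S2 * g₀ ^ 2 * M₁) + 4 * (W₀ * g₀ ^ 2 * S2 * M₂) := by linarith
  refine hfin.trans (le_of_eq ?_)
  rw [hS2, hM₁, hM₂]
  ring

end G2

/-! ### The `G₁` block: restriction to `P_H⁴` up to an error controlled by `|P_S|` -/

section G1

variable {ι : Type*} [Fintype ι] [DecidableEq ι] {σ : ι → ι} {P : Finset ι} {t : ι → ℝ} {e : ι → Momentum}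

/-- `∑_{p'} ∑_{q'} [e p + e q = e p' + e q'] [p' ∈ S] ≤ |S|`. [folklore] -/
theorem sum_sum_ite_mom_mem_left_le (he : Function.Injective e) (S : Finset ι) (p q : ι) :
    ∑ p', ∑ q', (if e p + e q = e p' + e q' then (if p' ∈ S then (1 : ℝ) else 0) else 0) ≤ S.card := by
  calc ∑ p', ∑ q', (if e p + e q = e p' + e q' then (if p' ∈ S then (1 : ℝ) else 0) else 0)
      ≤ ∑ p', (if p' ∈ S then (1 : ℝ) else 0) :=
        Finset.sum_le_sum fun p' _ => sum_ite_mom_const_le he p q p' (by split_ifs <;> norm_num)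
    _ = S.card := by rw [Finset.sum_boole]; simp

/-- `∑_{p'} ∑_{q'} [e p + e q = e p' + e q'] [q' ∈ S] ≤ |S|`. [folklore] -/
theorem sum_sum_ite_mom_mem_right_le (he : Function.Injective e) (S : Finset ι) (p q : ι) :
    ∑ p', ∑ q', (if e p + e q = e p' + e q' then (if q' ∈ S then (1 : ℝ) else 0) else 0) ≤ S.card := by
  rw [Finset.sum_comm]
  have hiff : ∀ p' q', (e p + e q = e p' + e q') ↔ (e p' = e p + e q - e q') := fun p' q' => by
    constructor <;> intro h
    · rw [h]; abel
    · rw [h]; abel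
  calc ∑ q', ∑ p', (if e p + e q = e p' + e q' then (if q' ∈ S then (1 : ℝ) else 0) else 0)
      ≤ ∑ q', (if q' ∈ S then (1 : ℝ) else 0) := by
        refine Finset.sum_le_sum fun q' _ => ?_
        simp only [hiff]
        exact sum_ite_momentum_const_le he _ (by split_ifs <;> norm_num)
    _ = S.card := by rw [Finset.sum_boole]; simp

set_option maxHeartbeats 1000000 in
/-- **The `G₁` (pair-annihilation) block restricted to `P_H⁴`.** For a vector `ξ` with `a_pξ = 0`
off `P_H ∪ P_S`, weighted-homogeneous for the `P_H/P_S` count (weight `1` on `P_H`, `-2` on `P_S`),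
`|γ_p| ≤ g₀` on `P_H ∪ P_S` and `|W| ≤ W₀`,
`|∑_{p,q,p',q'} c γ_qγ_pγ_{q'}γ_{p'} ⟨a_qa_pξ, a_{q'}a_{p'}ξ⟩ - ∑_{p,q,p',q' ∈ P_H} (same)| ≤ 2W₀g₀⁴|P_S| ∑‖a_ya_xξ‖²`:
a non-vanishing term outside `P_H⁴` has a `P_S` mode on each side ("the operator preserves the
number of particles in `P_S` and in `P_H`"), and the momentum constraint leaves at most `|P_S|`
partners — the bound `C N^{κ-1}‖γ_{S∪H}‖²_∞‖γ_S‖²‖(𝒩+1)ξ_ν‖²` of [ibid.] (`‖γ_S‖² ∼ |P_S|`).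
[cite: BastiCenatiempoSchlein2021, §4 (the treatment of `G₁`, restriction to `𝒱_N^{(H)}`)] -/
theorem norm_G1_sub_H_le (he : Function.Injective e) {PH PS : Finset ι} (hHS : Disjoint PH PS)
    (W : Momentum → ℂ) {W₀ : ℝ} (hW : ∀ k, ‖W k‖ ≤ W₀) {g₀ : ℝ} (hg₀ : 0 ≤ g₀)
    (hgQ : ∀ p ∈ PH ∪ PS, |bogGamma σ P t p| ≤ g₀) (ξ : MvPolynomial ι ℂ) (hξ : ∀ p ∉ PH ∪ PS, pderiv p ξ = 0)
    {m : ℤ} (hwt : IsWeightedHomogeneous (fun i : ι => if i ∈ PH then (1 : ℤ) else if i ∈ PS then -2 else 0) ξ m) :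
    ‖(∑ p, ∑ q, ∑ p', ∑ q', pairCoeff' e W p q p' q' *
        ((bogGamma σ P t q * bogGamma σ P t p * (bogGamma σ P t q' * bogGamma σ P t p') : ℝ) : ℂ) *
          fockInner (pderiv q (pderiv p ξ)) (pderiv q' (pderiv p' ξ))) -
      (∑ p ∈ PH, ∑ q ∈ PH, ∑ p' ∈ PH, ∑ q' ∈ PH, pairCoeff' e W p q p' q' *
        ((bogGamma σ P t q * bogGamma σ P t p * (bogGamma σ P t q' * bogGamma σ P t p') : ℝ) : ℂ) *
          fockInner (pderiv q (pderiv p ξ)) (pderiv q' (pderiv p' ξ)))‖ ≤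
      2 * W₀ * g₀ ^ 4 * PS.card * ∑ x, ∑ y, (fockInner (pderiv y (pderiv x ξ)) (pderiv y (pderiv x ξ))).re := by
  classical
  set g := bogGamma σ P t with hg
  set F : ι → ι → ι → ι → ℂ := fun p q p' q' => pairCoeff' e W p q p' q' *
    (((g q * g p * (g q' * g p')) : ℝ) : ℂ) * fockInner (pderiv q (pderiv p ξ)) (pderiv q' (pderiv p' ξ)) with hF
  set M₂ : ℝ := ∑ x, ∑ y, (fockInner (pderiv y (pderiv x ξ)) (pderiv y (pderiv x ξ))).re with hM₂
  have hW₀ : 0 ≤ W₀ := le_trans (norm_nonneg _) (hW 0)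
  set nn : ι → ι → ℝ := fun x y => (fockInner (pderiv y (pderiv x ξ)) (pderiv y (pderiv x ξ))).re with hnn
  have hnn0 : ∀ x y, 0 ≤ nn x y := fun x y => fockInner_self_re_nonneg _
  -- (1) the difference as a single sum with the indicator of "not all in `P_H`"
  have hdiff : (∑ p, ∑ q, ∑ p', ∑ q', F p q p' q') - (∑ p ∈ PH, ∑ q ∈ PH, ∑ p' ∈ PH, ∑ q' ∈ PH, F p q p' q') =
      ∑ p, ∑ q, ∑ p', ∑ q', (if p ∈ PH ∧ q ∈ PH ∧ p' ∈ PH ∧ q' ∈ PH then 0 else F p q p' q') := by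
    have hH : ∑ p ∈ PH, ∑ q ∈ PH, ∑ p' ∈ PH, ∑ q' ∈ PH, F p q p' q' =
        ∑ p, ∑ q, ∑ p', ∑ q', (if p ∈ PH ∧ q ∈ PH ∧ p' ∈ PH ∧ q' ∈ PH then F p q p' q' else 0) := by
      rw [← Finset.sum_ite_mem_eq PH]
      refine Finset.sum_congr rfl fun p _ => ?_
      by_cases hp : p ∈ PH
      · rw [if_pos hp, ← Finset.sum_ite_mem_eq PH]
        refine Finset.sum_congr rfl fun q _ => ?_
        by_cases hq : q ∈ PH
        · rw [if_pos hq, ← Finset.sum_ite_mem_eq PH]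
          refine Finset.sum_congr rfl fun p' _ => ?_
          by_cases hp' : p' ∈ PH
          · rw [if_pos hp', ← Finset.sum_ite_mem_eq PH]
            refine Finset.sum_congr rfl fun q' _ => ?_
            simp only [hp, hq, hp', true_and]
          · rw [if_neg hp']
            exact (Finset.sum_eq_zero fun q' _ => if_neg (fun h => hp' h.2.2.1)).symm
        · rw [if_neg hq]
          exact (Finset.sum_eq_zero fun p' _ => Finset.sum_eq_zero fun q' _ => if_neg (fun h => hq h.2.1)).symm
      · rw [if_neg hp]
        exact (Finset.sum_eq_zero fun q _ => Finset.sum_eq_zero fun p' _ => Finset.sum_eq_zero fun q' _ =>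
          if_neg (fun h => hp h.1)).symm
    rw [hH]
    simp only [← Finset.sum_sub_distrib]
    refine Finset.sum_congr rfl fun p _ => Finset.sum_congr rfl fun q _ => Finset.sum_congr rfl fun p' _ =>
      Finset.sum_congr rfl fun q' _ => ?_
    split_ifs <;> simp
  -- (2) vanishing of the inner product unless the `P_S`-counts agree
  set w : ι → ℤ := fun i => if i ∈ PH then (1 : ℤ) else if i ∈ PS then -2 else 0 with hw
  have hgrade : ∀ p q p' q', w p + w q ≠ w p' + w q' →
      fockInner (pderiv q (pderiv p ξ)) (pderiv q' (pderiv p' ξ)) = 0 := by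
    intro p q p' q' hne
    have h1 : IsWeightedHomogeneous w (pderiv q (pderiv p ξ)) (m - w p - w q) :=
      isWeightedHomogeneous_pderiv (isWeightedHomogeneous_pderiv hwt p) q
    have h2 : IsWeightedHomogeneous w (pderiv q' (pderiv p' ξ)) (m - w p' - w q') :=
      isWeightedHomogeneous_pderiv (isWeightedHomogeneous_pderiv hwt p') q'
    refine fockInner_eq_zero_of_isWeightedHomogeneous_ne h1 h2 ?_
    intro h; apply hne; linarith
  -- (3) the termwise bound
  have hterm : ∀ p q p' q', ‖(if p ∈ PH ∧ q ∈ PH ∧ p' ∈ PH ∧ q' ∈ PH then 0 else F p q p' q')‖ ≤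
      (if e p + e q = e p' + e q' then W₀ * g₀ ^ 4 *
        (((if p' ∈ PS then (1 : ℝ) else 0) + (if q' ∈ PS then 1 else 0)) * nn p q +
          ((if p ∈ PS then (1 : ℝ) else 0) + (if q ∈ PS then 1 else 0)) * nn p' q') / 2 else 0) := by
    intro p q p' q'
    have hrhs0 : 0 ≤ (if e p + e q = e p' + e q' then W₀ * g₀ ^ 4 *
        (((if p' ∈ PS then (1 : ℝ) else 0) + (if q' ∈ PS then 1 else 0)) * nn p q +
          ((if p ∈ PS then (1 : ℝ) else 0) + (if q ∈ PS then 1 else 0)) * nn p' q') / 2 else 0) := by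
      have := hnn0 p q; have := hnn0 p' q'
      have hi1 : 0 ≤ (if p' ∈ PS then (1 : ℝ) else 0) + (if q' ∈ PS then 1 else 0) :=
        add_nonneg (by split_ifs <;> norm_num) (by split_ifs <;> norm_num)
      have hi2 : 0 ≤ (if p ∈ PS then (1 : ℝ) else 0) + (if q ∈ PS then 1 else 0) :=
        add_nonneg (by split_ifs <;> norm_num) (by split_ifs <;> norm_num)
      by_cases hm : e p + e q = e p' + e q'
      · rw [if_pos hm]
        exact div_nonneg (mul_nonneg (mul_nonneg hW₀ (pow_nonneg hg₀ 4))
          (add_nonneg (mul_nonneg hi1 (hnn0 p q)) (mul_nonneg hi2 (hnn0 p' q')))) (by norm_num)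
      · rw [if_neg hm]
    by_cases hallH : p ∈ PH ∧ q ∈ PH ∧ p' ∈ PH ∧ q' ∈ PH
    · rw [if_pos hallH, norm_zero]; exact hrhs0
    rw [if_neg hallH]
    -- if the term vanishes we are done
    by_cases hF0 : F p q p' q' = 0
    · rw [hF0, norm_zero]; exact hrhs0
    -- otherwise: momentum conserved, all four modes in `P_H ∪ P_S`, and the `P_S`-counts agree
    have hmom : e p + e q = e p' + e q' := by
      by_contra hm; apply hF0; simp only [hF, pairCoeff', if_neg hm, zero_mul]
    have hL0 : pderiv q (pderiv p ξ) ≠ 0 := fun h => hF0 (by simp only [hF, h, fockInner_zero_left, mul_zero])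
    have hR0 : pderiv q' (pderiv p' ξ) ≠ 0 := fun h => hF0 (by simp only [hF, h, fockInner_zero_right, mul_zero])
    have memQ : ∀ {x y : ι}, pderiv y (pderiv x ξ) ≠ 0 → x ∈ PH ∪ PS ∧ y ∈ PH ∪ PS := by
      intro x y h
      constructor
      · by_contra hx; exact h (by rw [hξ x hx, map_zero])
      · by_contra hy; exact h (by rw [pderiv_pderiv_comm, hξ y hy, map_zero])
    obtain ⟨hpQ, hqQ⟩ := memQ hL0
    obtain ⟨hp'Q, hq'Q⟩ := memQ hR0
    have hwteq : w p + w q = w p' + w q' := by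
      by_contra hne; apply hF0; simp only [hF, hgrade p q p' q' hne, mul_zero]
    -- membership dichotomies and weights
    have hdisj : ∀ {x : ι}, x ∈ PH → x ∉ PS := fun hx hx' => Finset.disjoint_left.1 hHS hx hx'
    have hwH : ∀ {x : ι}, x ∈ PH → w x = 1 := fun hx => by simp [hw, hx]
    have hwS : ∀ {x : ι}, x ∈ PS → w x = -2 := fun {x} hx => by
      have hxH : x ∉ PH := fun h => hdisj h hx
      simp only [hw, if_neg hxH, if_pos hx]
    have hcase : ∀ {x : ι}, x ∈ PH ∪ PS → (x ∈ PH ∧ w x = 1) ∨ (x ∈ PS ∧ w x = -2) := by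
      intro x hx
      rcases Finset.mem_union.1 hx with h | h
      · exact Or.inl ⟨h, hwH h⟩
      · exact Or.inr ⟨h, hwS h⟩
    -- a `P_S` mode on each side
    have hS' : p' ∈ PS ∨ q' ∈ PS := by
      by_contra hnot
      have hp'H : p' ∈ PH := (Finset.mem_union.1 hp'Q).resolve_right (fun h => hnot (Or.inl h))
      have hq'H : q' ∈ PH := (Finset.mem_union.1 hq'Q).resolve_right (fun h => hnot (Or.inr h))
      have hw2 := hwteq
      rw [hwH hp'H, hwH hq'H] at hw2
      rcases hcase hpQ with ⟨hp, wp⟩ | ⟨hp, wp⟩ <;> rcases hcase hqQ with ⟨hq, wq⟩ | ⟨hq, wq⟩ <;>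
        rw [wp, wq] at hw2
      · exact hallH ⟨hp, hq, hp'H, hq'H⟩
      all_goals norm_num at hw2
    have hS : p ∈ PS ∨ q ∈ PS := by
      by_contra hnot
      have hpH : p ∈ PH := (Finset.mem_union.1 hpQ).resolve_right (fun h => hnot (Or.inl h))
      have hqH : q ∈ PH := (Finset.mem_union.1 hqQ).resolve_right (fun h => hnot (Or.inr h))
      have hw2 := hwteq
      rw [hwH hpH, hwH hqH] at hw2
      rcases hcase hp'Q with ⟨hp', wp'⟩ | ⟨hp', wp'⟩ <;> rcases hcase hq'Q with ⟨hq', wq'⟩ | ⟨hq', wq'⟩ <;>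
        rw [wp', wq'] at hw2
      · exact hallH ⟨hpH, hqH, hp', hq'⟩
      all_goals norm_num at hw2
    have hind' : (1 : ℝ) ≤ (if p' ∈ PS then (1 : ℝ) else 0) + (if q' ∈ PS then 1 else 0) := by
      rcases hS' with h | h
      · rw [if_pos h]; split_ifs <;> norm_num
      · rw [if_pos h]; split_ifs <;> norm_num
    have hind : (1 : ℝ) ≤ (if p ∈ PS then (1 : ℝ) else 0) + (if q ∈ PS then 1 else 0) := by
      rcases hS with h | h
      · rw [if_pos h]; split_ifs <;> norm_num
      · rw [if_pos h]; split_ifs <;> norm_num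
    -- the norm of the term
    rw [if_pos hmom]
    have hγ : |g q * g p * (g q' * g p')| ≤ g₀ ^ 4 := by
      rw [abs_mul, abs_mul, abs_mul]
      have h1 := hgQ p hpQ; have h2 := hgQ q hqQ; have h3 := hgQ p' hp'Q; have h4 := hgQ q' hq'Q
      calc |g q| * |g p| * (|g q'| * |g p'|) ≤ g₀ * g₀ * (g₀ * g₀) :=
            mul_le_mul (mul_le_mul h2 h1 (abs_nonneg _) hg₀) (mul_le_mul h4 h3 (abs_nonneg _) hg₀)
              (by positivity) (by positivity)
        _ = g₀ ^ 4 := by ring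
    have hcs := norm_fockInner_le_sqrt_mul_sqrt (pderiv q (pderiv p ξ)) (pderiv q' (pderiv p' ξ))
    set l := Real.sqrt (nn p q) with hl
    set r := Real.sqrt (nn p' q') with hr
    have hl2 : l ^ 2 = nn p q := Real.sq_sqrt (hnn0 _ _)
    have hr2 : r ^ 2 = nn p' q' := Real.sq_sqrt (hnn0 _ _)
    have hamgm : l * r ≤ (nn p q + nn p' q') / 2 := by nlinarith [sq_nonneg (l - r)]
    have hlr0 : 0 ≤ l * r := mul_nonneg (Real.sqrt_nonneg _) (Real.sqrt_nonneg _)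
    calc ‖F p q p' q'‖ = ‖pairCoeff' e W p q p' q'‖ * |g q * g p * (g q' * g p')| *
          ‖fockInner (pderiv q (pderiv p ξ)) (pderiv q' (pderiv p' ξ))‖ := by
          rw [hF, norm_mul, norm_mul, Complex.norm_real, Real.norm_eq_abs]
      _ ≤ W₀ * g₀ ^ 4 * (l * r) := by
          have hc : ‖pairCoeff' e W p q p' q'‖ ≤ W₀ := by simp only [pairCoeff', if_pos hmom]; exact hW _
          exact mul_le_mul (mul_le_mul hc hγ (abs_nonneg _) hW₀) hcs (norm_nonneg _) (by positivity)
      _ ≤ W₀ * g₀ ^ 4 * ((nn p q + nn p' q') / 2) := mul_le_mul_of_nonneg_left hamgm (by positivity)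
      _ ≤ W₀ * g₀ ^ 4 * ((((if p' ∈ PS then (1 : ℝ) else 0) + (if q' ∈ PS then 1 else 0)) * nn p q +
          ((if p ∈ PS then (1 : ℝ) else 0) + (if q ∈ PS then 1 else 0)) * nn p' q') / 2) := by
          refine mul_le_mul_of_nonneg_left ?_ (by positivity)
          have h1 := mul_le_mul_of_nonneg_right hind' (hnn0 p q)
          have h2 := mul_le_mul_of_nonneg_right hind (hnn0 p' q')
          linarith
      _ = _ := by ring
  -- (4) sum the termwise bound
  rw [hdiff]
  calc ‖∑ p, ∑ q, ∑ p', ∑ q', (if p ∈ PH ∧ q ∈ PH ∧ p' ∈ PH ∧ q' ∈ PH then 0 else F p q p' q')‖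
      ≤ ∑ p, ∑ q, ∑ p', ∑ q', (if e p + e q = e p' + e q' then W₀ * g₀ ^ 4 *
        (((if p' ∈ PS then (1 : ℝ) else 0) + (if q' ∈ PS then 1 else 0)) * nn p q +
          ((if p ∈ PS then (1 : ℝ) else 0) + (if q ∈ PS then 1 else 0)) * nn p' q') / 2 else 0) :=
        norm_sum_le_of_le _ fun p _ => norm_sum_le_of_le _ fun q _ => norm_sum_le_of_le _ fun p' _ =>
          norm_sum_le_of_le _ fun q' _ => hterm p q p' q'
    _ = W₀ * g₀ ^ 4 / 2 * ((∑ p, ∑ q, ∑ p', ∑ q', (if e p + e q = e p' + e q' then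
          ((if p' ∈ PS then (1 : ℝ) else 0) + (if q' ∈ PS then 1 else 0)) * nn p q else 0)) +
        ∑ p, ∑ q, ∑ p', ∑ q', (if e p + e q = e p' + e q' then
          ((if p ∈ PS then (1 : ℝ) else 0) + (if q ∈ PS then 1 else 0)) * nn p' q' else 0)) := by
        rw [← Finset.sum_add_distrib, Finset.mul_sum]
        refine Finset.sum_congr rfl fun p _ => ?_
        rw [← Finset.sum_add_distrib, Finset.mul_sum]
        refine Finset.sum_congr rfl fun q _ => ?_
        rw [← Finset.sum_add_distrib, Finset.mul_sum]
        refine Finset.sum_congr rfl fun p' _ => ?_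
        rw [← Finset.sum_add_distrib, Finset.mul_sum]
        refine Finset.sum_congr rfl fun q' _ => ?_
        split_ifs <;> ring
    _ ≤ W₀ * g₀ ^ 4 / 2 * ((2 * PS.card) * M₂ + (2 * PS.card) * M₂) := by
        refine mul_le_mul_of_nonneg_left (add_le_add ?_ ?_) (by positivity)
        · -- `(p, q)` outside, count the `(p', q')`
          calc ∑ p, ∑ q, ∑ p', ∑ q', (if e p + e q = e p' + e q' then
                ((if p' ∈ PS then (1 : ℝ) else 0) + (if q' ∈ PS then 1 else 0)) * nn p q else 0)
              = ∑ p, ∑ q, nn p q * ((∑ p', ∑ q', (if e p + e q = e p' + e q' then (if p' ∈ PS then (1 : ℝ) else 0) else 0)) +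
                  ∑ p', ∑ q', (if e p + e q = e p' + e q' then (if q' ∈ PS then (1 : ℝ) else 0) else 0)) := by
                refine Finset.sum_congr rfl fun p _ => Finset.sum_congr rfl fun q _ => ?_
                rw [← Finset.sum_add_distrib, Finset.mul_sum]
                refine Finset.sum_congr rfl fun p' _ => ?_
                rw [← Finset.sum_add_distrib, Finset.mul_sum]
                refine Finset.sum_congr rfl fun q' _ => ?_
                split_ifs <;> ring
            _ ≤ ∑ p, ∑ q, nn p q * ((PS.card : ℝ) + PS.card) :=
                Finset.sum_le_sum fun p _ => Finset.sum_le_sum fun q _ => mul_le_mul_of_nonneg_left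
                  (add_le_add (sum_sum_ite_mom_mem_left_le he PS p q) (sum_sum_ite_mom_mem_right_le he PS p q)) (hnn0 p q)
            _ = (2 * PS.card) * M₂ := by
                rw [hM₂, Finset.mul_sum]
                refine Finset.sum_congr rfl fun p _ => ?_
                rw [Finset.mul_sum]
                refine Finset.sum_congr rfl fun q _ => ?_
                simp only [hnn]; ring
        · -- `(p', q')` outside: swap the two blocks first
          rw [sum_comm₂₂]
          calc ∑ p', ∑ q', ∑ p, ∑ q, (if e p + e q = e p' + e q' then
                ((if p ∈ PS then (1 : ℝ) else 0) + (if q ∈ PS then 1 else 0)) * nn p' q' else 0)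
              = ∑ p', ∑ q', nn p' q' * ((∑ p, ∑ q, (if e p' + e q' = e p + e q then (if p ∈ PS then (1 : ℝ) else 0) else 0)) +
                  ∑ p, ∑ q, (if e p' + e q' = e p + e q then (if q ∈ PS then (1 : ℝ) else 0) else 0)) := by
                refine Finset.sum_congr rfl fun p' _ => Finset.sum_congr rfl fun q' _ => ?_
                rw [← Finset.sum_add_distrib, Finset.mul_sum]
                refine Finset.sum_congr rfl fun p _ => ?_
                rw [← Finset.sum_add_distrib, Finset.mul_sum]
                refine Finset.sum_congr rfl fun q _ => ?_
                simp only [eq_comm]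
                split_ifs <;> ring
            _ ≤ ∑ p', ∑ q', nn p' q' * ((PS.card : ℝ) + PS.card) :=
                Finset.sum_le_sum fun p' _ => Finset.sum_le_sum fun q' _ => mul_le_mul_of_nonneg_left
                  (add_le_add (sum_sum_ite_mom_mem_left_le he PS p' q') (sum_sum_ite_mom_mem_right_le he PS p' q'))
                  (hnn0 p' q')
            _ = (2 * PS.card) * M₂ := by
                rw [hM₂, Finset.mul_sum]
                refine Finset.sum_congr rfl fun p' _ => ?_
                rw [Finset.mul_sum]
                refine Finset.sum_congr rfl fun q' _ => ?_
                simp only [hnn]; ring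
    _ = 2 * W₀ * g₀ ^ 4 * PS.card * M₂ := by ring

end G1

/-! ### The quadratic block `ℒ⁽²⁾`: `∑_p (2W(0)+W(p)+W(-p))‖B_pξ‖² + ∑_p (W(-p)⟨B_{σp}B_pξ,ξ⟩ + h.c.)` -/

section L2

variable {ι : Type*} [Fintype ι] [DecidableEq ι] {σ : ι → ι} {P : Finset ι} {t : ι → ℝ} {e : ι → Momentum}

/-- **The `N₀`-block of the Weyl-reduced quartic form, expanded for a graded vector.** With
`B_p = γ_pa_p + σ_pa†_{σp}` and `ξ` weighted-homogeneous of constant weight `g`, `2g ≠ 0`,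
`∑_p (2W(0)+W(e p)+W(-e p))⟨B_pξ,B_pξ⟩ + ∑_p (W(-e p)⟨B_{σp}B_pξ, ξ⟩ + W(e p)⟨ξ, B_{σp}B_pξ⟩)`
`= (∑_p [(2W(0)+W(e p)+W(-e p))σ_p² + (W(e p)+W(-e p))γ_pσ_p])‖ξ‖²`
`+ ∑_p [(2W(0)+W(e p)+W(-e p))(γ_p²‖a_pξ‖² + σ_p²‖a_{σp}ξ‖²) + (W(e p)+W(-e p))γ_pσ_p(‖a_{σp}ξ‖² + ‖a_pξ‖²)]`:
the constant `𝒢_N^{(2,V)}`-expectation `(N₀/N)∑[N^κV̂(p/N^{1-κ}) + N^κV̂(0)]σ_p² + N^κV̂ γ_pσ_p` of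
[ibid.] plus number-operator terms.
[cite: BastiCenatiempoSchlein2021, §4 (the constant and `a†a` parts of `T*_νℒ^{(2)}_NT_ν`)] -/
theorem L2_block_expand {M : Type*} [AddCommGroup M] {g : M} (h2 : 2 • g ≠ 0)
    (hσ : Function.Involutive σ) (hP : ∀ p ∈ P, σ p ∉ P) (W : Momentum → ℂ)
    {ξ : MvPolynomial ι ℂ} {m : M} (hξ : IsWeightedHomogeneous (fun _ : ι => g) ξ m) :
    (∑ p, (2 * W 0 + W (e p) + W (-e p)) * fockInner (bogAn σ P t p ξ) (bogAn σ P t p ξ)) +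
      ∑ p, (W (-e p) * fockInner (bogAn σ P t (σ p) (bogAn σ P t p ξ)) ξ +
        W (e p) * fockInner ξ (bogAn σ P t (σ p) (bogAn σ P t p ξ))) =
      (∑ p, ((2 * W 0 + W (e p) + W (-e p)) * ((bogSigma σ P t p ^ 2 : ℝ) : ℂ) +
        (W (e p) + W (-e p)) * ((bogGamma σ P t p * bogSigma σ P t p : ℝ) : ℂ))) * fockInner ξ ξ +
      ∑ p, ((2 * W 0 + W (e p) + W (-e p)) *
          (((bogGamma σ P t p ^ 2 : ℝ) : ℂ) * fockInner (pderiv p ξ) (pderiv p ξ) +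
            ((bogSigma σ P t p ^ 2 : ℝ) : ℂ) * fockInner (pderiv (σ p) ξ) (pderiv (σ p) ξ)) +
        (W (e p) + W (-e p)) * ((bogGamma σ P t p * bogSigma σ P t p : ℝ) : ℂ) *
          (fockInner (pderiv (σ p) ξ) (pderiv (σ p) ξ) + fockInner (pderiv p ξ) (pderiv p ξ))) := by
  rw [Finset.sum_mul, ← Finset.sum_add_distrib, ← Finset.sum_add_distrib]
  refine Finset.sum_congr rfl fun p _ => ?_
  rw [fockInner_bogAn_bogAn'_of_graded h2 hξ, fockInner_self_bogAn_bogAn_of_graded h2 hξ,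
    fockInner_bogAn_bogAn_self_of_graded h2 hξ, if_pos rfl, hσ p, bogGamma_partner hσ hP,
    bogSigma_partner hσ hP]
  push_cast
  ring

/-- **The `N₀`-block bounded**: for an even real-valued-on-the-diagonal `W` with `|W| ≤ W₀` and a
vector annihilated off a set `Q` on which `γ_p² ≤ g₀²`, `σ_p² ≤ s₀²`, `|γ_pσ_p| ≤ gs₀`,
`|ℒ⁽²⁾-block - (∑_p [(2W(0)+W(e p)+W(-e p))σ_p² + (W(e p)+W(-e p))γ_pσ_p])‖ξ‖²| ≤ 4W₀(g₀² + s₀² + gs₀)∑‖a_pξ‖²`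
— the number-operator part of `T*ℒ^{(2)}T` is `≤ CN^{κ}(…)𝒩` [ibid., §4].
[cite: BastiCenatiempoSchlein2021, §4 (bounds on the `a†a` parts of `T*_νℒ^{(2)}_NT_ν`)] -/
theorem norm_L2_block_sub_const_le {M : Type*} [AddCommGroup M] {g : M} (h2 : 2 • g ≠ 0)
    (hσ : Function.Involutive σ) (hP : ∀ p ∈ P, σ p ∉ P) (W : Momentum → ℂ) {W₀ : ℝ}
    (hW : ∀ k, ‖W k‖ ≤ W₀) (Q : Finset ι) (hQσ : ∀ p ∈ Q, σ p ∈ Q) {g₀ s₀ gs₀ : ℝ}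
    (hgQ : ∀ p ∈ Q, |bogGamma σ P t p| ≤ g₀) (hsQ : ∀ p ∈ Q, |bogSigma σ P t p| ≤ s₀)
    (hgsQ : ∀ p ∈ Q, |bogGamma σ P t p * bogSigma σ P t p| ≤ gs₀)
    {ξ : MvPolynomial ι ℂ} {m : M} (hξ : IsWeightedHomogeneous (fun _ : ι => g) ξ m)
    (hξQ : ∀ p ∉ Q, pderiv p ξ = 0) :
    ‖(∑ p, (2 * W 0 + W (e p) + W (-e p)) * fockInner (bogAn σ P t p ξ) (bogAn σ P t p ξ)) +
      (∑ p, (W (-e p) * fockInner (bogAn σ P t (σ p) (bogAn σ P t p ξ)) ξ +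
        W (e p) * fockInner ξ (bogAn σ P t (σ p) (bogAn σ P t p ξ)))) -
      (∑ p, ((2 * W 0 + W (e p) + W (-e p)) * ((bogSigma σ P t p ^ 2 : ℝ) : ℂ) +
        (W (e p) + W (-e p)) * ((bogGamma σ P t p * bogSigma σ P t p : ℝ) : ℂ))) * fockInner ξ ξ‖ ≤
      4 * W₀ * (g₀ ^ 2 + s₀ ^ 2 + gs₀) * ∑ p, (fockInner (pderiv p ξ) (pderiv p ξ)).re := by
  rw [L2_block_expand h2 hσ hP W hξ, add_sub_cancel_left]
  have hW₀ : 0 ≤ W₀ := le_trans (norm_nonneg _) (hW 0)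
  set n1 : ι → ℝ := fun p => (fockInner (pderiv p ξ) (pderiv p ξ)).re with hn1
  have hn10 : ∀ p, 0 ≤ n1 p := fun p => fockInner_self_re_nonneg _
  have hn1σ : ∀ p, (fockInner (pderiv (σ p) ξ) (pderiv (σ p) ξ)) = (n1 (σ p) : ℂ) := fun p => by
    rw [fockInner_self_eq_re]
  have hn1p : ∀ p, (fockInner (pderiv p ξ) (pderiv p ξ)) = (n1 p : ℂ) := fun p => by
    rw [fockInner_self_eq_re]
  have hoff : ∀ p ∉ Q, n1 p = 0 := fun p hp => by
    simp only [hn1, hξQ p hp, fockInner_zero_left, Complex.zero_re]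
  have h3W : ∀ p, ‖2 * W 0 + W (e p) + W (-e p)‖ ≤ 4 * W₀ := fun p => by
    calc ‖2 * W 0 + W (e p) + W (-e p)‖ ≤ ‖2 * W 0‖ + ‖W (e p)‖ + ‖W (-e p)‖ := norm_add₃_le
      _ ≤ 2 * W₀ + W₀ + W₀ := by
          rw [norm_mul, Complex.norm_two]
          exact add_le_add (add_le_add (mul_le_mul_of_nonneg_left (hW 0) (by norm_num)) (hW _)) (hW _)
      _ = 4 * W₀ := by ring
  have h2W : ∀ p, ‖W (e p) + W (-e p)‖ ≤ 2 * W₀ := fun p => by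
    calc ‖W (e p) + W (-e p)‖ ≤ ‖W (e p)‖ + ‖W (-e p)‖ := norm_add_le _ _
      _ ≤ W₀ + W₀ := add_le_add (hW _) (hW _)
      _ = 2 * W₀ := by ring
  -- termwise bound
  have hterm : ∀ p, ‖(2 * W 0 + W (e p) + W (-e p)) *
        (((bogGamma σ P t p ^ 2 : ℝ) : ℂ) * fockInner (pderiv p ξ) (pderiv p ξ) +
          ((bogSigma σ P t p ^ 2 : ℝ) : ℂ) * fockInner (pderiv (σ p) ξ) (pderiv (σ p) ξ)) +
        (W (e p) + W (-e p)) * ((bogGamma σ P t p * bogSigma σ P t p : ℝ) : ℂ) *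
          (fockInner (pderiv (σ p) ξ) (pderiv (σ p) ξ) + fockInner (pderiv p ξ) (pderiv p ξ))‖ ≤
      4 * W₀ * (g₀ ^ 2 * n1 p + s₀ ^ 2 * n1 (σ p)) + 2 * W₀ * gs₀ * (n1 (σ p) + n1 p) := by
    intro p
    rw [hn1σ, hn1p]
    -- the bounds on `γ², σ², |γσ|` where they matter
    have hg2 : bogGamma σ P t p ^ 2 * n1 p ≤ g₀ ^ 2 * n1 p := by
      by_cases hp : p ∈ Q
      · refine mul_le_mul_of_nonneg_right ?_ (hn10 p)
        rw [← sq_abs]; exact pow_le_pow_left₀ (abs_nonneg _) (hgQ p hp) 2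
      · rw [hoff p hp, mul_zero, mul_zero]
    have hs2 : bogSigma σ P t p ^ 2 * n1 (σ p) ≤ s₀ ^ 2 * n1 (σ p) := by
      by_cases hp : σ p ∈ Q
      · refine mul_le_mul_of_nonneg_right ?_ (hn10 _)
        rw [← bogSigma_partner hσ hP p, ← sq_abs]; exact pow_le_pow_left₀ (abs_nonneg _) (hsQ _ hp) 2
      · rw [hoff _ hp, mul_zero, mul_zero]
    have hgs : |bogGamma σ P t p * bogSigma σ P t p| * (n1 (σ p) + n1 p) ≤ gs₀ * (n1 (σ p) + n1 p) := by
      by_cases hp : p ∈ Q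
      · exact mul_le_mul_of_nonneg_right (hgsQ p hp) (add_nonneg (hn10 _) (hn10 _))
      · have hσp : σ p ∉ Q := fun h => hp (by simpa [hσ p] using hQσ _ h)
        rw [hoff p hp, hoff _ hσp, add_zero, mul_zero, mul_zero]
    calc _ ≤ ‖(2 * W 0 + W (e p) + W (-e p)) *
          (((bogGamma σ P t p ^ 2 : ℝ) : ℂ) * (n1 p : ℂ) + ((bogSigma σ P t p ^ 2 : ℝ) : ℂ) * (n1 (σ p) : ℂ))‖ +
          ‖(W (e p) + W (-e p)) * ((bogGamma σ P t p * bogSigma σ P t p : ℝ) : ℂ) * ((n1 (σ p) : ℂ) + (n1 p : ℂ))‖ :=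
          norm_add_le _ _
      _ ≤ 4 * W₀ * (g₀ ^ 2 * n1 p + s₀ ^ 2 * n1 (σ p)) + 2 * W₀ * (gs₀ * (n1 (σ p) + n1 p)) := by
          refine add_le_add ?_ ?_
          · rw [norm_mul]
            have hin : ‖((bogGamma σ P t p ^ 2 : ℝ) : ℂ) * (n1 p : ℂ) + ((bogSigma σ P t p ^ 2 : ℝ) : ℂ) * (n1 (σ p) : ℂ)‖ ≤
                g₀ ^ 2 * n1 p + s₀ ^ 2 * n1 (σ p) := by
              have hre : ((bogGamma σ P t p ^ 2 : ℝ) : ℂ) * (n1 p : ℂ) + ((bogSigma σ P t p ^ 2 : ℝ) : ℂ) * (n1 (σ p) : ℂ) =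
                  ((bogGamma σ P t p ^ 2 * n1 p + bogSigma σ P t p ^ 2 * n1 (σ p) : ℝ) : ℂ) := by push_cast; ring
              rw [hre, Complex.norm_real, Real.norm_of_nonneg (add_nonneg (mul_nonneg (sq_nonneg _) (hn10 _))
                (mul_nonneg (sq_nonneg _) (hn10 _)))]
              exact add_le_add hg2 hs2
            exact mul_le_mul (h3W p) hin (norm_nonneg _) (by positivity)
          · rw [norm_mul, norm_mul, Complex.norm_real, Real.norm_eq_abs]
            have hsum : ‖(n1 (σ p) : ℂ) + (n1 p : ℂ)‖ = n1 (σ p) + n1 p := by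
              rw [← Complex.ofReal_add, Complex.norm_real, Real.norm_of_nonneg (add_nonneg (hn10 _) (hn10 _))]
            rw [hsum, mul_assoc]
            exact mul_le_mul (h2W p) hgs (mul_nonneg (abs_nonneg _) (add_nonneg (hn10 _) (hn10 _))) (by positivity)
      _ = _ := by ring
  -- sum up
  have hσsum : ∑ p, n1 (σ p) = ∑ p, n1 p := sum_comp_involutive hσ n1
  calc _ ≤ ∑ p, (4 * W₀ * (g₀ ^ 2 * n1 p + s₀ ^ 2 * n1 (σ p)) + 2 * W₀ * gs₀ * (n1 (σ p) + n1 p)) :=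
        norm_sum_le_of_le _ fun p _ => hterm p
    _ = 4 * W₀ * (g₀ ^ 2 + s₀ ^ 2 + gs₀) * ∑ p, n1 p := by
        simp only [Finset.sum_add_distrib, ← Finset.mul_sum]
        rw [hσsum]; ring

end L2

end Fock

end Literature.MathematicalPhysics.QuantumManyBody.BoseGas

end
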